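import Literature.Combinatorics.Optimization.TsirelsonExtremalCorrelations
import Literature.Combinatorics.Optimization.SemidefiniteFarkasAlternative
import Literature.Combinatorics.Optimization.CompletelyPsdRank
import Mathlib.Analysis.InnerProductSpace.GramMatrix
import Mathlib.Data.Sym.Card
import Mathlib.Data.Sym.Sym2.Order
import HarnessLib

/-!
# Gribling–de Laat–Laurent (2017) §3: extreme bipartite correlation matrices of rank `r` in
# `Cor(r, binom(r,2)+1)` (Theorem 3.11 (i)), via Tsirelson's certificate (Theorem 3.9 (ii))

Source. S. Gribling, D. de Laat, M. Laurent, *Matrices with high completely positive semidefinite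
rank*, Linear Algebra Appl. 513 (2017) 122–148 = arXiv:1605.00988 [GriblingDelaatLaurent2017], §3
"The set of bipartite correlations" (held text `paper:arxiv-1605.00988`, corpus-tex chunks p08–p12:
§3.1 Lemma 3.1 [ELV14], Lemma 3.2 [Tsirelson:87], Theorem 3.3, Lemma 3.4, Theorem 3.5 [LiTam],
Example 3.6; §3.2 Theorem 3.7 [LV14], Lemma 3.8, Theorem 3.9 [Tsirelson], Corollary 3.10; §3.3 the two
constructions and Theorem 3.11). The set `Cor(m,n)` of bipartite correlation matrices (p08: "there
exist real unit vectors `x_1,…,x_m, y_1,…,y_n ∈ ℝ^d` (for some `d ≥ 1`) such that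
`C_{s,t} = ⟨x_s, y_t⟩`") is the tree's `quantumCorrelations m n` (`TsirelsonExtremalCorrelations.lean`,
unit vectors in `ℝ^{m+n}`, which is no restriction: `m + n` vectors span at most `m + n` dimensions;
see `corPad` below for the embedding used here).

## What is typed

* **Theorem 3.9 (ii)** (p10, [Tsirelson]: "If `E` is an extreme point of `𝓔_{m+n}` and there exist
  strictly positive scalars `λ_1,…,λ_m, μ_1,…,μ_n` for which relation (eqTsi)
  `Σ_s λ_s x_sx_sᵀ = Σ_t μ_t y_ty_tᵀ` holds, then `C` is an extreme point of `Cor(m,n)`"; GdLL: "The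
  construction of such a matrix `Ω` is analogous to the construction given in [CG] … so we omit the
  details") — PROVED in the special case that the proof of Theorem 1.1 uses (the first construction
  of §3.3 has `x_s = e_s`, `m = r`): `mem_extremePoints_quantumCorrelations_of_certificate`. Hypotheses:
  unit vectors `y_t ∈ ℝ^r`, weights `μ_t > 0` with `Σ_t μ_t y_ty_tᵀ = λ I_r` (relation (eqTsi) with
  `x_s = e_s`, `λ_s = λ`), and the Li–Tam extremality condition of Theorem 3.5 for the Gram vectors
  `e_1,…,e_r,y_1,…,y_n` of `E` ("`binom(r+1,2) = dim span{z_iz_iᵀ}`", typed dually: a symmetric matrix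
  orthogonal to all `z_iz_iᵀ` vanishes). Conclusion: `C = (⟨e_s, y_t⟩) = (y_t(s))` is an extreme
  point of `Cor(r,n)`. Own elementary proof (not the omitted [CG]/[LV14] stress-matrix route, but its
  shadow): for any `C`-system `{u_s, v_t}` of a point `C'` of `Cor(r,n)`,
  `0 ≤ Σ_t μ_t ‖v_t − Σ_s y_t(s)u_s‖² = Σ_t μ_t + λr − 2Σ_{s,t} μ_t y_t(s) C'_{st}`, so the linear
  functional `L(C') = Σ μ_t y_t(s) C'_{st}` is maximised over `Cor(r,n)` exactly at the points whose
  `C`-systems satisfy `v_t = Σ_s y_t(s) u_s`; for those, `Gram(u) − I` is symmetric with zero diagonal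
  and orthogonal to every `y_ty_tᵀ`, hence zero by the Li–Tam condition, so `C' = C`: the face of
  `Cor(r,n)` exposed by `L` is `{C}` (this `L` is the dual certificate `Ω` of Theorem 3.7 in disguise).
* `rank_eq_of_certificate`: under (eqTsi) with `λ ≠ 0`, `rank C = r` (Lemma 3.2 (ii): `rank C =
  rank E`).
* **§3.3, first construction, and Theorem 3.11 (i)** (p11–p12, verbatim): "There exists a matrix `C_1`
  which is an extreme point of `C(r, binom(r,2)+1)` and has rank `r`. We can take `C_1` to be the
  matrix with columns `(e_i−e_j)/√2` (for `1 ≤ i < j ≤ r`) and `(e_1+…+e_r)/√r`": `gdllVec`,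
  `gdllCorrelation`, `gdllCorrelation_mem_extremePoints`, `rank_gdllCorrelation`,
  `GriblingDelaatLaurent2017_thm311i`; the certificate is `μ_{ij} = 2`, `μ_e = r`, `λ = r`
  (`Σ_{i<j}(e_i−e_j)(e_i−e_j)ᵀ + 𝟙𝟙ᵀ = rI`, the identities `B̂B̂ᵀ = rI_r − J_r`, `BBᵀ = rI_r` of p11).
  The column index set is `GdllIdx r = {(i,j) : i < j} ⊔ {e}` of size `binom(r,2) + 1`
  (`card_gdllIdx`), numbered by `Fintype.equivFin`.

* Appended: the projection `π : 𝓔_{n+m} → Cor(n,m)` (`offDiag_mem_quantumCorrelations_of_posSemidef`),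
  the NECESSITY of the Li–Tam condition for extreme points (Theorems 3.3 and 3.5, "only if" parts
  combined: `litam_of_mem_extremePoints`, own elementary perturbation proof) and Tsirelson's weak bound
  `binom(rank C + 1, 2) ≤ n + m` for extreme `C` (p09; `choose_rank_succ_le_of_mem_extremePoints`).

* Appended: **Theorem 3.9 (i)** [Tsirelson] (`GriblingDelaatLaurent2017_thm39i`: for an extreme `C` and
  any `C`-system, nonnegative `λ, μ`, not all zero, with `Σ_s λ_s x_sx_sᵀ = Σ_t μ_t y_ty_tᵀ`; proof as
  printed, through the theorem of the alternative Lemma 3.8 = `GriblingDelaatLaurent2017_lemma38` of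
  `SemidefiniteFarkasAlternative.lean` and the uniqueness of the extension Lemma 3.2 (ii) =
  `gram_sumElim_eq_of_mem_extremePoints`) and **Corollary 3.10**, Tsirelson's sharp bound
  `binom(rank C + 1, 2) ≤ n + m − 1` (`GriblingDelaatLaurent2017_cor310`).

ELSEWHERE in the tree: **Theorem 3.5** [LiTam] (= PSVW Theorem 13, Li–Tam's characterization of the
extreme points of the elliptope `𝓔_n`, both directions) is `mem_extremePoints_elliptope_iff_gram`, with
`elliptope n`, in `CompletelyPsdRank.lean` — not restated publicly here.

* Appended: **Theorem 3.3** as ONE statement on the tree's `elliptope (n + m)`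
  (`GriblingDelaatLaurent2017_thm33`): `C` is an extreme point of `Cor(n,m)` iff it has a unique
  extension to a matrix of `𝓔_{n+m}` (its off-diagonal block under `Fin.castAdd`/`Fin.natAdd`) and that
  extension is an extreme point of `𝓔_{n+m}`. Proof over the index type `Fin n ⊕ Fin m` (private
  `thm33_sum`, with Li–Tam's criterion in Gram form for an arbitrary finite index type, `litam_gram_iff`,
  an elementary perturbation / right-inverse proof kept private since the `Fin`-indexed statement is
  `mem_extremePoints_elliptope_iff_gram`), transported by `Matrix.reindexLinearEquiv` along
  `finSumFinEquiv` (`image_extremePoints`).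

NOT typed: Lemma 3.1 [ELV14], Lemma 3.4, Theorem 3.7 [LV14], Theorem 3.9 (ii) in general (GdLL omit its
proof), the second construction `C_2` (Theorem 3.11 (ii)) and the XOR-game discussion.
-/

noncomputable section

open Matrix Finset
open scoped RealInnerProductSpace MatrixOrder

namespace Literature.Combinatorics.Optimization

/-! ### Zero-padding `ℝ^r → ℝ^{r+m}` -/

/-- Zero-padding `ℝ^r → ℝ^{r+m}`, `f ↦ (f, 0)` (to place a `C`-system of `Cor(r,m)` given in `ℝ^r`
into the ambient space `ℝ^{r+m}` of `quantumCorrelations r m`). [folklore] -/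
def corPad (r m : ℕ) (f : EuclideanSpace ℝ (Fin r)) : EuclideanSpace ℝ (Fin (r + m)) :=
  WithLp.toLp 2 (Fin.addCases (fun i => f i) (fun _ => (0 : ℝ)))

/-- Zero-padding preserves inner products. [folklore] -/
private theorem inner_corPad {r m : ℕ} (f g : EuclideanSpace ℝ (Fin r)) :
    ⟪corPad r m f, corPad r m g⟫ = ⟪f, g⟫ := by
  simp only [corPad, EuclideanSpace.inner_toLp_toLp, star_trivial, dotProduct, Fin.sum_univ_add,
    Fin.addCases_left, Fin.addCases_right, mul_zero, Finset.sum_const_zero, add_zero]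
  rw [EuclideanSpace.inner_eq_star_dotProduct, star_trivial, dotProduct]

/-- Zero-padding preserves norms. [folklore] -/
private theorem norm_corPad {r m : ℕ} (f : EuclideanSpace ℝ (Fin r)) : ‖corPad r m f‖ = ‖f‖ := by
  rw [norm_eq_sqrt_real_inner, inner_corPad, ← norm_eq_sqrt_real_inner]

/-! ### Theorem 3.9 (ii) with `x_s = e_s`: extremality from Tsirelson's certificate -/

section Certificate

variable {r m : ℕ}

/-- `⟨e_s, f⟩ = f(s)`. [folklore] -/
private theorem inner_single_one_left (s : Fin r) (f : EuclideanSpace ℝ (Fin r)) :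
    ⟪EuclideanSpace.single s (1 : ℝ), f⟫ = f s := by
  rw [EuclideanSpace.inner_single_left, map_one, one_mul]

/-- `‖f‖² = Σ_p f(p)²` on `ℝ^r`, in product form. [folklore] -/
private theorem norm_sq_eq_sum_mul (f : EuclideanSpace ℝ (Fin r)) : ‖f‖ ^ 2 = ∑ p, f p * f p := by
  rw [EuclideanSpace.real_norm_sq_eq]
  exact Finset.sum_congr rfl fun p _ => sq (f p)

/-- Expansion `‖v − Σ_s c_s u_s‖² = ‖v‖² − 2 Σ_s c_s ⟨u_s, v⟩ + Σ_{s,s'} c_s c_{s'} ⟨u_s, u_{s'}⟩` in a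
real inner product space. [folklore] -/
private theorem norm_sub_sum_smul_sq {F : Type*} [NormedAddCommGroup F] [InnerProductSpace ℝ F]
    (v : F) (u : Fin r → F) (c : Fin r → ℝ) :
    ‖v - ∑ s, c s • u s‖ ^ 2 =
      ‖v‖ ^ 2 - 2 * ∑ s, c s * ⟪u s, v⟫ + ∑ s, ∑ s', c s * c s' * ⟪u s, u s'⟫ := by
  rw [norm_sub_sq_real, inner_sum, ← real_inner_self_eq_norm_sq (∑ s, c s • u s), sum_inner]
  congr 1
  · congr 1; congr 1
    exact Finset.sum_congr rfl fun s _ => by rw [real_inner_smul_right, real_inner_comm]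
  · refine Finset.sum_congr rfl fun s _ => ?_
    rw [real_inner_smul_left, inner_sum, Finset.mul_sum]
    exact Finset.sum_congr rfl fun s' _ => by rw [real_inner_smul_right, mul_assoc]

/-- **GdLL Theorem 3.9 (ii) [Tsirelson], the case `x_s = e_s`** (p10): let `y_1,…,y_m ∈ ℝ^r` be unit
vectors and `μ_t > 0` weights with `Σ_t μ_t y_ty_tᵀ = λ I_r` (relation (eqTsi) with `x_s = e_s`,
`λ_s = λ`), and suppose the Gram vectors `e_1,…,e_r,y_1,…,y_m` satisfy the Li–Tam condition of Theorem
3.5 (the matrices `z_iz_iᵀ` span `𝒮^r`; typed dually: a symmetric `A` with `A_{ss} = 0` and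
`y_tᵀAy_t = 0` for all `s, t` is zero). Then `C = (⟨e_s, y_t⟩)_{s,t} = (y_t(s))` is an extreme point of
`Cor(r,m)`. Proof (own, elementary; GdLL omit theirs, "analogous to … [CG]"): the functional
`L(C') = Σ_{s,t} μ_t y_t(s) C'_{st}` satisfies, for every `C`-system `{u_s}, {v_t}` of `C' ∈ Cor(r,m)`,
`Σ_t μ_t‖v_t − Σ_s y_t(s)u_s‖² = 2Σ_tμ_t − 2L(C')` (using `Σ_tμ_t y_ty_tᵀ = λI` and
`λr = Σ_tμ_t`), so `L ≤ Σ_tμ_t` on `Cor(r,m)` with equality iff `v_t = Σ_s y_t(s)u_s` for all `t`;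
then `Gram(u) − I` is symmetric, has zero diagonal and is orthogonal to every `y_ty_tᵀ`
(`‖v_t‖ = ‖y_t‖ = 1`), hence vanishes, and `C' = C`. So `{C}` is the face of `Cor(r,m)` exposed by `L`.
[cite: GriblingDelaatLaurent2017, Thm. 3.9 (ii) (p10) and §3.3 (p11)] -/
theorem mem_extremePoints_quantumCorrelations_of_certificate
    (y : Fin m → EuclideanSpace ℝ (Fin r)) (hy : ∀ t, ‖y t‖ = 1) (μ : Fin m → ℝ) (hμ : ∀ t, 0 < μ t)
    (lam : ℝ) (hcert : ∀ p q : Fin r, ∑ t, μ t * (y t p * y t q) = if p = q then lam else 0)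
    (hspan : ∀ A : Matrix (Fin r) (Fin r) ℝ, A.IsSymm → (∀ p, A p p = 0) →
      (∀ t, ∑ p, ∑ q, A p q * (y t p * y t q) = 0) → A = 0) :
    (Matrix.of fun s t => y t s) ∈ Set.extremePoints ℝ (quantumCorrelations r m) := by
  classical
  set C : Matrix (Fin r) (Fin m) ℝ := Matrix.of fun s t => y t s with hCdef
  -- the functional `L` and its value at `C`
  let L : Matrix (Fin r) (Fin m) ℝ → ℝ := fun C' => ∑ t, μ t * ∑ s, y t s * C' s t
  have hLadd : ∀ (a b : ℝ) (C₁ C₂ : Matrix (Fin r) (Fin m) ℝ),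
      L (a • C₁ + b • C₂) = a * L C₁ + b * L C₂ := by
    intro a b C₁ C₂
    simp only [L, Matrix.add_apply, Matrix.smul_apply, smul_eq_mul, Finset.mul_sum, ← Finset.sum_add_distrib]
    refine Finset.sum_congr rfl fun t _ => Finset.sum_congr rfl fun s _ => by ring
  have hysq : ∀ t, ∑ p, y t p * y t p = 1 := fun t => by
    rw [← norm_sq_eq_sum_mul, hy, one_pow]
  have hLC : L C = ∑ t, μ t := by
    refine Finset.sum_congr rfl fun t _ => ?_
    simp only [hCdef, Matrix.of_apply, hysq, mul_one]
  -- `λ r = Σ_t μ_t` (trace of the certificate)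
  have hlam : lam * r = ∑ t, μ t := by
    have h1 : ∑ p : Fin r, ∑ t, μ t * (y t p * y t p) = ∑ p : Fin r, lam :=
      Finset.sum_congr rfl fun p _ => by rw [hcert, if_pos rfl]
    rw [Finset.sum_const, Finset.card_univ, Fintype.card_fin, nsmul_eq_mul, Finset.sum_comm] at h1
    rw [mul_comm, ← h1]
    refine Finset.sum_congr rfl fun t _ => ?_
    rw [← Finset.mul_sum, hysq, mul_one]
  -- the key estimate: `L ≤ Σ μ` on `Cor(r,m)`, with equality only at `C`
  have key : ∀ C' ∈ quantumCorrelations r m, L C' ≤ ∑ t, μ t ∧ (L C' = ∑ t, μ t → C' = C) := by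
    intro C' hC'
    obtain ⟨u, v, hu, hv, hC'⟩ := hC'
    -- `S = Σ_t μ_t ‖v_t − Σ_s y_t(s) u_s‖² = 2 Σ μ − 2 L(C')`
    have hcross : ∀ t, ∑ s, y t s * ⟪u s, v t⟫ = ∑ s, y t s * C' s t := fun t =>
      Finset.sum_congr rfl fun s _ => by rw [hC']
    have hquad : ∑ t, μ t * ∑ s, ∑ s', y t s * y t s' * ⟪u s, u s'⟫ = lam * r := by
      calc ∑ t, μ t * ∑ s, ∑ s', y t s * y t s' * ⟪u s, u s'⟫
          = ∑ s, ∑ s', ⟪u s, u s'⟫ * ∑ t, μ t * (y t s * y t s') := by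
            simp only [Finset.mul_sum]
            rw [Finset.sum_comm]
            refine Finset.sum_congr rfl fun s _ => ?_
            rw [Finset.sum_comm]
            exact Finset.sum_congr rfl fun s' _ => Finset.sum_congr rfl fun t _ => by ring
        _ = ∑ s : Fin r, ⟪u s, u s⟫ * lam := by
            refine Finset.sum_congr rfl fun s _ => ?_
            simp only [hcert, mul_ite, mul_zero, Finset.sum_ite_eq, Finset.mem_univ, if_true]
        _ = lam * r := by
            simp only [real_inner_self_eq_norm_sq, hu, one_pow, one_mul, Finset.sum_const,
              Finset.card_univ, Fintype.card_fin, nsmul_eq_mul]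
            ring
    have hS : ∑ t, μ t * ‖v t - ∑ s, y t s • u s‖ ^ 2 = 2 * ∑ t, μ t - 2 * L C' := by
      have h1 : ∑ t, μ t * ‖v t - ∑ s, y t s • u s‖ ^ 2 =
          ∑ t, (μ t - 2 * (μ t * ∑ s, y t s * C' s t) +
            μ t * ∑ s, ∑ s', y t s * y t s' * ⟪u s, u s'⟫) := by
        refine Finset.sum_congr rfl fun t _ => ?_
        rw [norm_sub_sum_smul_sq, hv, one_pow, hcross]
        ring
      rw [h1, Finset.sum_add_distrib, Finset.sum_sub_distrib, hquad, hlam, ← Finset.mul_sum]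
      ring
    have hSnn : ∀ t, 0 ≤ μ t * ‖v t - ∑ s, y t s • u s‖ ^ 2 := fun t =>
      mul_nonneg (hμ t).le (sq_nonneg _)
    have hS0 : 0 ≤ ∑ t, μ t * ‖v t - ∑ s, y t s • u s‖ ^ 2 := Finset.sum_nonneg fun t _ => hSnn t
    refine ⟨by linarith, fun hL => ?_⟩
    -- equality: every `v_t = Σ_s y_t(s) u_s`
    have hzero : ∑ t, μ t * ‖v t - ∑ s, y t s • u s‖ ^ 2 = 0 := by rw [hS, hL]; ring
    have hvt : ∀ t, v t = ∑ s, y t s • u s := by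
      intro t
      have h := (Finset.sum_eq_zero_iff_of_nonneg fun t _ => hSnn t).mp hzero t (Finset.mem_univ t)
      rcases mul_eq_zero.mp h with h0 | h0
      · exact absurd h0 (hμ t).ne'
      · rw [sq_eq_zero_iff, norm_eq_zero, sub_eq_zero] at h0
        exact h0
    -- `Gram(u) − I` is symmetric, zero on the diagonal and orthogonal to the `y_t y_tᵀ`
    let A : Matrix (Fin r) (Fin r) ℝ := Matrix.of fun s s' => ⟪u s, u s'⟫ - if s = s' then 1 else 0
    have hAsymm : A.IsSymm := by
      ext s s'
      simp only [A, Matrix.transpose_apply, Matrix.of_apply]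
      rw [real_inner_comm]
      by_cases h : s = s'
      · subst h; rfl
      · rw [if_neg h, if_neg (Ne.symm h)]
    have hAdiag : ∀ s, A s s = 0 := fun s => by
      simp [A, hu]
    have hvnorm : ∀ t, ∑ s, ∑ s', ⟪u s, u s'⟫ * (y t s * y t s') = 1 := fun t => by
      have h := hv t
      rw [hvt t] at h
      have h2 : ‖∑ s, y t s • u s‖ ^ 2 = 1 := by rw [h, one_pow]
      rw [← real_inner_self_eq_norm_sq, sum_inner] at h2
      rw [← h2]
      refine Finset.sum_congr rfl fun s _ => ?_
      rw [real_inner_smul_left, inner_sum, Finset.mul_sum]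
      exact Finset.sum_congr rfl fun s' _ => by rw [real_inner_smul_right]; ring
    have hAy : ∀ t, ∑ p, ∑ q, A p q * (y t p * y t q) = 0 := fun t => by
      simp only [A, Matrix.of_apply, sub_mul, Finset.sum_sub_distrib, hvnorm t, ite_mul, one_mul,
        zero_mul, Finset.sum_ite_eq, Finset.mem_univ, if_true, hysq t, sub_self]
    have hA0 := hspan A hAsymm hAdiag hAy
    have huu : ∀ s s', ⟪u s, u s'⟫ = if s = s' then 1 else 0 := fun s s' => by
      have h := congrFun (congrFun hA0 s) s'
      simp only [A, Matrix.of_apply, Matrix.zero_apply, sub_eq_zero] at h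
      exact h
    -- hence `C' = C`
    ext s t
    rw [hC', hvt t, inner_sum]
    simp only [real_inner_smul_right, huu, mul_ite, mul_one, mul_zero, Finset.sum_ite_eq,
      Finset.mem_univ, if_true, hCdef, Matrix.of_apply]
  -- membership: the `C`-system `e_s, y_t`, padded into `ℝ^{r+m}`
  have hmem : C ∈ quantumCorrelations r m := by
    refine ⟨fun s => corPad r m (EuclideanSpace.single s (1 : ℝ)), fun t => corPad r m (y t),
      fun s => ?_, fun t => ?_, fun s t => ?_⟩
    · rw [norm_corPad, PiLp.norm_single, norm_one]
    · rw [norm_corPad, hy]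
    · rw [inner_corPad, inner_single_one_left, hCdef, Matrix.of_apply]
  -- extremality
  refine ⟨hmem, fun C₁ hC₁ C₂ hC₂ hseg => ?_⟩
  obtain ⟨a, b, ha, hb, hab, hCab⟩ := hseg
  obtain ⟨h1, h1'⟩ := key C₁ hC₁
  obtain ⟨h2, -⟩ := key C₂ hC₂
  have hLeq : a * L C₁ + b * L C₂ = ∑ t, μ t := by rw [← hLadd, hCab, hLC]
  have hL1 : L C₁ = ∑ t, μ t := by
    by_contra hne
    have hlt : L C₁ < ∑ t, μ t := lt_of_le_of_ne h1 hne
    have hlt' : a * L C₁ + b * L C₂ < a * ∑ t, μ t + b * ∑ t, μ t :=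
      add_lt_add_of_lt_of_le (mul_lt_mul_of_pos_left hlt ha) (mul_le_mul_of_nonneg_left h2 hb.le)
    rw [← add_mul, hab, one_mul, hLeq] at hlt'
    exact lt_irrefl _ hlt'
  exact h1' hL1

/-- Under the certificate `Σ_t μ_t y_ty_tᵀ = λ I_r` with `λ ≠ 0` the matrix `C = (y_t(s))_{s,t}` has
rank `r` (`C · diag(μ) · Cᵀ = λ I_r`; GdLL Lemma 3.2 (ii): "`rank(E) = rank(C)`", here `E = Gram(e_s,
y_t)` has rank `r`). [cite: GriblingDelaatLaurent2017, Lemma 3.2 (ii) (p08–p09)] -/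
theorem rank_eq_of_certificate (y : Fin m → EuclideanSpace ℝ (Fin r)) (μ : Fin m → ℝ) (lam : ℝ)
    (hlam : lam ≠ 0) (hcert : ∀ p q : Fin r, ∑ t, μ t * (y t p * y t q) = if p = q then lam else 0) :
    (Matrix.of fun s t => y t s : Matrix (Fin r) (Fin m) ℝ).rank = r := by
  classical
  set C : Matrix (Fin r) (Fin m) ℝ := Matrix.of fun s t => y t s with hCdef
  apply le_antisymm
  · exact (Matrix.rank_le_card_height C).trans (by simp)
  · have hprod : C * (Matrix.diagonal μ * Cᵀ) = lam • (1 : Matrix (Fin r) (Fin r) ℝ) := by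
      ext p q
      rw [← Matrix.mul_assoc, Matrix.mul_apply, Matrix.smul_apply, Matrix.one_apply, smul_eq_mul,
        mul_ite, mul_one, mul_zero, ← hcert p q]
      refine Finset.sum_congr rfl fun t _ => ?_
      rw [Matrix.mul_diagonal, Matrix.transpose_apply, hCdef, Matrix.of_apply, Matrix.of_apply]
      ring
    have hunit : IsUnit (lam • (1 : Matrix (Fin r) (Fin r) ℝ)) := by
      rw [Matrix.isUnit_iff_isUnit_det, Matrix.det_smul, Matrix.det_one, mul_one]
      exact (pow_ne_zero _ hlam).isUnit
    have hrank : (lam • (1 : Matrix (Fin r) (Fin r) ℝ)).rank = r := by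
      rw [Matrix.rank_of_isUnit _ hunit, Fintype.card_fin]
    calc r = (C * (Matrix.diagonal μ * Cᵀ)).rank := by rw [hprod, hrank]
      _ ≤ C.rank := Matrix.rank_mul_le_left _ _

end Certificate

/-! ### §3.3, first construction: the extreme point `C_1` of `Cor(r, binom(r,2)+1)` (Theorem 3.11 (i)) -/

section Construction

/-- Double sums against a difference of two indicator vectors:
`Σ_{p,q} B_{pq} (δ_{pi} − δ_{pj})(δ_{qi} − δ_{qj}) = B_{ii} − B_{ij} − B_{ji} + B_{jj}`. [folklore] -/
private theorem sum_sum_mul_ind_sub {r : ℕ} (B : Fin r → Fin r → ℝ) (i j : Fin r) :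
    ∑ p, ∑ q, B p q * (((if p = i then 1 else 0) - (if p = j then 1 else 0)) *
      ((if q = i then 1 else 0) - (if q = j then 1 else 0))) = B i i - B i j - B j i + B j j := by
  simp only [mul_sub, mul_ite, mul_one, mul_zero, Finset.sum_sub_distrib, Finset.sum_ite_eq',
    Finset.mem_univ, if_true]
  ring

/-- `Σ_q (δ_{qi} − δ_{qj})² = 2` for `i ≠ j`. [folklore] -/
private theorem sum_ind_sub_sq {r : ℕ} {i j : Fin r} (hij : i ≠ j) :
    ∑ q : Fin r, ((if q = i then (1 : ℝ) else 0) - (if q = j then 1 else 0)) *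
      ((if q = i then 1 else 0) - (if q = j then 1 else 0)) = 2 := by
  simp only [mul_sub, mul_ite, mul_one, mul_zero, Finset.sum_sub_distrib, Finset.sum_ite_eq',
    Finset.mem_univ, if_true, if_neg hij, if_neg (Ne.symm hij)]
  ring

/-- `Σ_{i,j} (a_i − a_j)(c_i − c_j) = 2(r Σ_i a_ic_i − (Σ_i a_i)(Σ_j c_j))`. [folklore] -/
private theorem sum_sum_sub_mul_sub {r : ℕ} (a c : Fin r → ℝ) :
    ∑ i, ∑ j, (a i - a j) * (c i - c j) = 2 * (r * ∑ i, a i * c i - (∑ i, a i) * ∑ i, c i) := by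
  have e1 : ∑ i : Fin r, ∑ _j : Fin r, a i * c i = r * ∑ i, a i * c i := by
    rw [Finset.mul_sum]
    refine Finset.sum_congr rfl fun i _ => ?_
    rw [Finset.sum_const, Finset.card_univ, Fintype.card_fin, nsmul_eq_mul]
  have e2 : ∑ i : Fin r, ∑ j : Fin r, a i * c j = (∑ i, a i) * ∑ i, c i := by
    rw [Finset.sum_mul]
    exact Finset.sum_congr rfl fun i _ => by rw [Finset.mul_sum]
  have e3 : ∑ i : Fin r, ∑ j : Fin r, a j * c i = (∑ i, a i) * ∑ i, c i := by
    rw [Finset.sum_comm, Finset.sum_mul]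
    exact Finset.sum_congr rfl fun i _ => by rw [Finset.mul_sum]
  have e4 : ∑ _i : Fin r, ∑ j : Fin r, a j * c j = r * ∑ i, a i * c i := by
    rw [Finset.sum_const, Finset.card_univ, Fintype.card_fin, nsmul_eq_mul]
  simp only [sub_mul, mul_sub, Finset.sum_sub_distrib]
  rw [e1, e2, e3, e4]
  ring

/-- Symmetrisation over ordered pairs: for a symmetric kernel `g`,
`2 Σ_{i<j} g(i,j) = Σ_{i,j} g(i,j) − Σ_i g(i,i)`. [folklore] -/
private theorem two_mul_sum_ltPairs {r : ℕ} (g : Fin r → Fin r → ℝ) (hg : ∀ i j, g i j = g j i) :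
    2 * ∑ p : {p : Fin r × Fin r // p.1 < p.2}, g p.1.1 p.1.2 = ∑ i, ∑ j, g i j - ∑ i, g i i := by
  classical
  have hsub : ∑ p : {p : Fin r × Fin r // p.1 < p.2}, g p.1.1 p.1.2 =
      ∑ p : Fin r × Fin r, if p.1 < p.2 then g p.1 p.2 else 0 := by
    rw [← Finset.sum_filter]
    exact (Finset.sum_subtype (Finset.univ.filter fun p : Fin r × Fin r => p.1 < p.2)
      (p := fun p : Fin r × Fin r => p.1 < p.2) (by simp) (fun a => g a.1 a.2)).symm
  have hswap : ∑ p : Fin r × Fin r, (if p.2 < p.1 then g p.1 p.2 else 0) =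
      ∑ p : Fin r × Fin r, if p.1 < p.2 then g p.1 p.2 else 0 := by
    rw [← Equiv.sum_comp (Equiv.prodComm (Fin r) (Fin r))]
    refine Finset.sum_congr rfl fun p _ => ?_
    simp only [Equiv.prodComm_apply, Prod.fst_swap, Prod.snd_swap, hg p.2 p.1]
  have hdiag : ∑ p : Fin r × Fin r, (if p.1 = p.2 then g p.1 p.2 else 0) = ∑ i, g i i := by
    rw [Fintype.sum_prod_type]
    refine Finset.sum_congr rfl fun i _ => ?_
    rw [Finset.sum_ite_eq, if_pos (Finset.mem_univ _)]
  have htot : ∑ i, ∑ j, g i j = ∑ p : Fin r × Fin r, ((if p.1 < p.2 then g p.1 p.2 else 0) +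
      (if p.2 < p.1 then g p.1 p.2 else 0) + (if p.1 = p.2 then g p.1 p.2 else 0)) := by
    rw [← Fintype.sum_prod_type']
    refine Finset.sum_congr rfl fun p _ => ?_
    rcases lt_trichotomy p.1 p.2 with h | h | h
    · rw [if_pos h, if_neg (lt_asymm h), if_neg (ne_of_lt h)]; ring
    · rw [if_neg (h ▸ lt_irrefl _), if_neg (h ▸ lt_irrefl _), if_pos h]; ring
    · rw [if_neg (lt_asymm h), if_pos h, if_neg (ne_of_gt h)]; ring
  rw [htot, Finset.sum_add_distrib, Finset.sum_add_distrib, hswap, hdiag, hsub]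
  ring

/-- The column index set of `C_1` (p11–p12): the pairs `1 ≤ i < j ≤ r` (columns `(e_i−e_j)/√2`) and
one more index (the column `(e_1+…+e_r)/√r`). [cite: GriblingDelaatLaurent2017, Thm. 3.11 (i) (p12)] -/
abbrev GdllIdx (r : ℕ) : Type := {p : Fin r × Fin r // p.1 < p.2} ⊕ Unit

/-- `|GdllIdx r| = binom(r,2) + 1` in the form `2(|GdllIdx r| − 1) = r² − r` … stated as
`|{(i,j) : i < j}| · 2 = r · r − r`. [folklore] -/
private theorem two_mul_card_ltPairs (r : ℕ) :
    2 * Fintype.card {p : Fin r × Fin r // p.1 < p.2} = r * r - r := by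
  have h := two_mul_sum_ltPairs (r := r) (fun _ _ => (1 : ℝ)) (fun _ _ => rfl)
  simp only [Finset.sum_const, Finset.card_univ, nsmul_eq_mul, mul_one, Fintype.card_fin] at h
  have h' : ((2 * Fintype.card {p : Fin r × Fin r // p.1 < p.2} : ℕ) : ℝ) = ((r * r - r : ℕ) : ℝ) := by
    rw [Nat.cast_sub (Nat.le_mul_self r)]
    push_cast
    linarith
  exact_mod_cast h'

/-- `|GdllIdx r| = binom(r,2) + 1` (p12: `C_1 ∈ Cor(r, binom(r,2)+1)`), as `r(r−1)/2 + 1`.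
[cite: GriblingDelaatLaurent2017, Thm. 3.11 (i) (p12)] -/
theorem card_gdllIdx (r : ℕ) : Fintype.card (GdllIdx r) = r * (r - 1) / 2 + 1 := by
  rw [Fintype.card_sum, Fintype.card_unit]
  congr 1
  have h := two_mul_card_ltPairs r
  have h2 : r * r - r = r * (r - 1) := by
    rw [Nat.mul_sub, mul_one]
  omega

/-- The columns of `C_1` as vectors of `ℝ^r` (p12, verbatim): "`(e_i−e_j)/√2` (for `1 ≤ i < j ≤ r`) and
`(e_1+…+e_r)/√r`". [cite: GriblingDelaatLaurent2017, Thm. 3.11 (i) (p12)] -/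
def gdllVec (r : ℕ) : GdllIdx r → EuclideanSpace ℝ (Fin r)
  | Sum.inl p => (Real.sqrt 2)⁻¹ • (EuclideanSpace.single p.1.1 (1 : ℝ) - EuclideanSpace.single p.1.2 (1 : ℝ))
  | Sum.inr _ => (Real.sqrt r)⁻¹ • ∑ i, EuclideanSpace.single i (1 : ℝ)

/-- The weights of the certificate `Σ_t μ_t y_ty_tᵀ = r I_r` for `C_1`: `μ = 2` on the pairs,
`μ = r` on the last column (`Σ_{i<j}(e_i−e_j)(e_i−e_j)ᵀ = B̂B̂ᵀ = rI_r − J_r`, p11, and `𝟙𝟙ᵀ = J_r`).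
[cite: GriblingDelaatLaurent2017, §3.3 (p11)] -/
def gdllWeight (r : ℕ) : GdllIdx r → ℝ
  | Sum.inl _ => 2
  | Sum.inr _ => r

/-- Coordinates of the column `(e_i−e_j)/√2` of `C_1`. [cite: GriblingDelaatLaurent2017, Thm. 3.11 (i) (p12)] -/
theorem gdllVec_inl_apply {r : ℕ} (p : {p : Fin r × Fin r // p.1 < p.2}) (q : Fin r) :
    gdllVec r (Sum.inl p) q =
      (Real.sqrt 2)⁻¹ * ((if q = p.1.1 then 1 else 0) - (if q = p.1.2 then 1 else 0)) := by
  simp [gdllVec]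

/-- Coordinates of the column `(e_1+…+e_r)/√r` of `C_1`. [cite: GriblingDelaatLaurent2017, Thm. 3.11 (i) (p12)] -/
theorem gdllVec_inr_apply {r : ℕ} (u : Unit) (q : Fin r) :
    gdllVec r (Sum.inr u) q = (Real.sqrt r)⁻¹ := by
  simp [gdllVec, Pi.single_apply, WithLp.ofLp_sum]

/-- The columns of `C_1` are unit vectors (`r ≥ 1`). [cite: GriblingDelaatLaurent2017, §3.3 (p11)] -/
theorem norm_gdllVec {r : ℕ} (hr : 1 ≤ r) (x : GdllIdx r) : ‖gdllVec r x‖ = 1 := by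
  have hsq : ‖gdllVec r x‖ ^ 2 = 1 := by
    rw [norm_sq_eq_sum_mul]
    rcases x with p | u
    · simp only [gdllVec_inl_apply]
      have hij : p.1.1 ≠ p.1.2 := ne_of_lt p.2
      calc ∑ q : Fin r, (Real.sqrt 2)⁻¹ * ((if q = p.1.1 then 1 else 0) - (if q = p.1.2 then 1 else 0)) *
            ((Real.sqrt 2)⁻¹ * ((if q = p.1.1 then 1 else 0) - (if q = p.1.2 then 1 else 0)))
          = (Real.sqrt 2)⁻¹ * (Real.sqrt 2)⁻¹ * ∑ q : Fin r, ((if q = p.1.1 then (1 : ℝ) else 0) -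
              (if q = p.1.2 then 1 else 0)) * ((if q = p.1.1 then 1 else 0) - (if q = p.1.2 then 1 else 0)) := by
            rw [Finset.mul_sum]; exact Finset.sum_congr rfl fun q _ => by ring
        _ = 1 := by
            rw [sum_ind_sub_sq hij, ← mul_inv, Real.mul_self_sqrt (by norm_num)]; norm_num
    · simp only [gdllVec_inr_apply, Finset.sum_const, Finset.card_univ, Fintype.card_fin, nsmul_eq_mul]
      have hr' : (0 : ℝ) < r := by exact_mod_cast hr
      rw [← mul_inv, Real.mul_self_sqrt hr'.le, mul_inv_cancel₀ hr'.ne']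
  have h0 : 0 ≤ ‖gdllVec r x‖ := norm_nonneg _
  nlinarith [hsq, h0]

/-- **The certificate** `Σ_t μ_t y_t y_tᵀ = r I_r` for `C_1` (`Σ_{i<j}(e_i−e_j)(e_i−e_j)ᵀ + 𝟙𝟙ᵀ =
(rI_r − J_r) + J_r`, the identities `B̂B̂ᵀ = rI_r − J_r`, `BBᵀ = rI_r` of p11).
[cite: GriblingDelaatLaurent2017, §3.3 (p11)] -/
theorem gdll_certificate {r : ℕ} (hr : 1 ≤ r) (p q : Fin r) :
    ∑ x : GdllIdx r, gdllWeight r x * (gdllVec r x p * gdllVec r x q) = if p = q then (r : ℝ) else 0 := by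
  classical
  rw [Fintype.sum_sum_type, Fintype.sum_unique (fun u : Unit =>
    gdllWeight r (Sum.inr u) * (gdllVec r (Sum.inr u) p * gdllVec r (Sum.inr u) q))]
  simp only [gdllWeight, gdllVec_inl_apply, gdllVec_inr_apply]
  have hr' : (0 : ℝ) < r := by exact_mod_cast hr
  have hlast : (r : ℝ) * ((Real.sqrt r)⁻¹ * (Real.sqrt r)⁻¹) = 1 := by
    rw [← mul_inv, Real.mul_self_sqrt hr'.le, mul_inv_cancel₀ hr'.ne']
  rw [hlast]
  -- the pair sum, by symmetrisation
  set g : Fin r → Fin r → ℝ := fun i j =>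
    ((if p = i then (1 : ℝ) else 0) - (if p = j then 1 else 0)) *
      ((if q = i then 1 else 0) - (if q = j then 1 else 0)) with hg
  have hgsymm : ∀ i j, g i j = g j i := fun i j => by simp only [hg]; ring
  have hpair : ∑ x : {p : Fin r × Fin r // p.1 < p.2},
      2 * ((Real.sqrt 2)⁻¹ * ((if p = x.1.1 then 1 else 0) - (if p = x.1.2 then 1 else 0)) *
        ((Real.sqrt 2)⁻¹ * ((if q = x.1.1 then 1 else 0) - (if q = x.1.2 then 1 else 0)))) =
      ∑ x : {p : Fin r × Fin r // p.1 < p.2}, g x.1.1 x.1.2 := by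
    refine Finset.sum_congr rfl fun x _ => ?_
    have h2 : (2 : ℝ) * ((Real.sqrt 2)⁻¹ * (Real.sqrt 2)⁻¹) = 1 := by
      rw [← mul_inv, Real.mul_self_sqrt (by norm_num)]; norm_num
    simp only [hg]
    calc 2 * ((Real.sqrt 2)⁻¹ * ((if p = x.1.1 then 1 else 0) - (if p = x.1.2 then 1 else 0)) *
          ((Real.sqrt 2)⁻¹ * ((if q = x.1.1 then 1 else 0) - (if q = x.1.2 then 1 else 0))))
        = (2 * ((Real.sqrt 2)⁻¹ * (Real.sqrt 2)⁻¹)) * (((if p = x.1.1 then 1 else 0) - (if p = x.1.2 then 1 else 0)) *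
          ((if q = x.1.1 then 1 else 0) - (if q = x.1.2 then 1 else 0))) := by ring
      _ = _ := by rw [h2, one_mul]
  rw [hpair]
  have hsym := two_mul_sum_ltPairs g hgsymm
  have hgii : ∀ i, g i i = 0 := fun i => by simp only [hg]; ring
  have hS1 : ∑ i : Fin r, (if p = i then (1 : ℝ) else 0) = 1 := by
    rw [Finset.sum_ite_eq, if_pos (Finset.mem_univ _)]
  have hS2 : ∑ i : Fin r, (if q = i then (1 : ℝ) else 0) = 1 := by
    rw [Finset.sum_ite_eq, if_pos (Finset.mem_univ _)]
  have hS3 : ∑ i : Fin r, (if p = i then (1 : ℝ) else 0) * (if q = i then 1 else 0) =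
      if p = q then 1 else 0 := by
    simp only [ite_mul, one_mul, zero_mul, Finset.sum_ite_eq, Finset.mem_univ, if_true]
    by_cases hpq : p = q
    · subst hpq; simp
    · rw [if_neg hpq, if_neg (Ne.symm hpq)]
  have htot : ∑ i, ∑ j, g i j = 2 * ((if p = q then (r : ℝ) else 0) - 1) := by
    have h := sum_sum_sub_mul_sub (fun i => if p = i then (1 : ℝ) else 0) (fun i => if q = i then (1 : ℝ) else 0)
    simp only [hg]
    rw [h, hS1, hS2, hS3]
    by_cases hpq : p = q
    · rw [if_pos hpq, if_pos hpq]; ring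
    · rw [if_neg hpq, if_neg hpq]; ring
  simp only [hgii, Finset.sum_const_zero, sub_zero] at hsym
  have : ∑ x : {p : Fin r × Fin r // p.1 < p.2}, g x.1.1 x.1.2 = (if p = q then (r : ℝ) else 0) - 1 := by
    linarith
  rw [this]
  ring

/-- **The Li–Tam condition** (Theorem 3.5) for the Gram vectors `e_1,…,e_r` and the columns of
`C_1`: a symmetric matrix with zero diagonal orthogonal to every `y_ty_tᵀ` is zero (testing against
`(e_i−e_j)/√2` kills `A_{ij}`; p11: "`E_1` … is an extreme point of `𝓔_{r+n}`").
[cite: GriblingDelaatLaurent2017, §3.3 (p11), Thm. 3.5 (p09)] -/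
theorem gdll_spanning {r : ℕ} (A : Matrix (Fin r) (Fin r) ℝ) (hA : A.IsSymm) (hdiag : ∀ p, A p p = 0)
    (horth : ∀ x : GdllIdx r, ∑ p, ∑ q, A p q * (gdllVec r x p * gdllVec r x q) = 0) : A = 0 := by
  have hoff : ∀ i j : Fin r, i < j → A i j = 0 := by
    intro i j hij
    have h := horth (Sum.inl ⟨(i, j), hij⟩)
    simp only [gdllVec_inl_apply] at h
    have h' : ∑ p, ∑ q, A p q * (((if p = i then 1 else 0) - (if p = j then 1 else 0)) *
        ((if q = i then 1 else 0) - (if q = j then 1 else 0))) = 0 := by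
      have : ∑ p, ∑ q, A p q * ((Real.sqrt 2)⁻¹ * ((if p = i then 1 else 0) - (if p = j then 1 else 0)) *
          ((Real.sqrt 2)⁻¹ * ((if q = i then 1 else 0) - (if q = j then 1 else 0)))) =
          (Real.sqrt 2)⁻¹ * (Real.sqrt 2)⁻¹ * ∑ p, ∑ q, A p q * (((if p = i then 1 else 0) -
            (if p = j then 1 else 0)) * ((if q = i then 1 else 0) - (if q = j then 1 else 0))) := by
        rw [Finset.mul_sum]
        refine Finset.sum_congr rfl fun p _ => ?_
        rw [Finset.mul_sum]
        exact Finset.sum_congr rfl fun q _ => by ring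
      rw [this] at h
      have hc : (Real.sqrt 2)⁻¹ * (Real.sqrt 2)⁻¹ ≠ 0 := by positivity
      exact (mul_eq_zero.mp h).resolve_left hc
    rw [sum_sum_mul_ind_sub, hdiag i, hdiag j] at h'
    have hji : A j i = A i j := by
      have := congrFun (congrFun hA i) j
      simpa [Matrix.transpose_apply] using this
    linarith
  ext i j
  rw [Matrix.zero_apply]
  rcases lt_trichotomy i j with h | h | h
  · exact hoff i j h
  · subst h; exact hdiag i
  · have := congrFun (congrFun hA j) i
    simp only [Matrix.transpose_apply] at this
    rw [this]
    exact hoff j i h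

/-- **The matrix `C_1`** (p12): the `r × (binom(r,2)+1)` matrix whose columns are `(e_i−e_j)/√2`
(`i < j`) and `(e_1+…+e_r)/√r`, the columns numbered by `Fintype.equivFin (GdllIdx r)`.
[cite: GriblingDelaatLaurent2017, Thm. 3.11 (i) (p12)] -/
def gdllCorrelation (r : ℕ) : Matrix (Fin r) (Fin (Fintype.card (GdllIdx r))) ℝ :=
  Matrix.of fun s t => gdllVec r ((Fintype.equivFin (GdllIdx r)).symm t) s

/-- **GdLL Theorem 3.11 (i), extremality** (p12): `C_1` is an extreme point of
`Cor(r, binom(r,2)+1)` (`r ≥ 1`), by Theorem 3.9 (ii) with the certificate `gdll_certificate` and the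
Li–Tam condition `gdll_spanning`. [cite: GriblingDelaatLaurent2017, Thm. 3.11 (i) (p12)] -/
theorem gdllCorrelation_mem_extremePoints {r : ℕ} (hr : 1 ≤ r) :
    gdllCorrelation r ∈ Set.extremePoints ℝ (quantumCorrelations r (Fintype.card (GdllIdx r))) := by
  classical
  let e := (Fintype.equivFin (GdllIdx r)).symm
  have h := mem_extremePoints_quantumCorrelations_of_certificate (r := r)
    (fun t => gdllVec r (e t)) (fun t => norm_gdllVec hr _) (fun t => gdllWeight r (e t))
    (fun t => by
      show 0 < gdllWeight r (e t)
      rcases e t with p | u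
      · show (0 : ℝ) < 2; norm_num
      · show (0 : ℝ) < r; exact_mod_cast hr)
    (r : ℝ)
    (fun p q => by
      rw [Equiv.sum_comp e (fun x => gdllWeight r x * (gdllVec r x p * gdllVec r x q))]
      exact gdll_certificate hr p q)
    (fun A hA hdiag horth => gdll_spanning A hA hdiag fun x => by
      have := horth (e.symm x)
      simpa only [Equiv.apply_symm_apply] using this)
  exact h

/-- **GdLL Theorem 3.11 (i), rank** (p12): `rank(C_1) = r` (`r ≥ 1`).
[cite: GriblingDelaatLaurent2017, Thm. 3.11 (i) (p12)] -/
theorem rank_gdllCorrelation {r : ℕ} (hr : 1 ≤ r) : (gdllCorrelation r).rank = r := by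
  classical
  let e := (Fintype.equivFin (GdllIdx r)).symm
  have hr' : (r : ℝ) ≠ 0 := by exact_mod_cast (show r ≠ 0 by omega)
  exact rank_eq_of_certificate (fun t => gdllVec r (e t)) (fun t => gdllWeight r (e t)) (r : ℝ) hr'
    (fun p q => by
      rw [Equiv.sum_comp e (fun x => gdllWeight r x * (gdllVec r x p * gdllVec r x q))]
      exact gdll_certificate hr p q)

/-- **GdLL Theorem 3.11 (i)** (p12, verbatim): "There exists a matrix `C_1` which is an extreme point
of `C(r, binom(r,2)+1)` and has rank `r`. We can take `C_1` to be the matrix with columns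
`(e_i−e_j)/√2` (for `1 ≤ i < j ≤ r`) and `(e_1+…+e_r)/√r`." Typed with `Cor` = `quantumCorrelations`
and `binom(r,2)+1 = |GdllIdx r| = r(r−1)/2 + 1` (`card_gdllIdx`); `r ≥ 1`.
[cite: GriblingDelaatLaurent2017, Thm. 3.11 (i) (p12)] -/
theorem GriblingDelaatLaurent2017_thm311i {r : ℕ} (hr : 1 ≤ r) :
    gdllCorrelation r ∈ Set.extremePoints ℝ (quantumCorrelations r (Fintype.card (GdllIdx r))) ∧
      (gdllCorrelation r).rank = r ∧ Fintype.card (GdllIdx r) = r * (r - 1) / 2 + 1 :=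
  ⟨gdllCorrelation_mem_extremePoints hr, rank_gdllCorrelation hr, card_gdllIdx r⟩

end Construction

/-! ### Necessity of the Li–Tam condition (Theorems 3.3 & 3.5 "only if") and Tsirelson's weak bound (appended) -/

section LiTamNecessity

variable {n m : ℕ}

/-- **The projection `π : 𝓔_{n+m} → Cor(n,m)`** (eq. (π), p08: "`Cor(m,n)` is a projection of the
elliptope `𝓔_{m+n}` and therefore a convex set"): a real psd matrix with unit diagonal indexed by
`[n] ⊔ [m]` has its off-diagonal block in `Cor(n,m)` (write `E = BᵀB`; the columns of `B` are unit
vectors of `ℝ^{n+m}`). [cite: GriblingDelaatLaurent2017, §3.1 eq. (π) (p08)] -/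
theorem offDiag_mem_quantumCorrelations_of_posSemidef
    {E : Matrix (Fin n ⊕ Fin m) (Fin n ⊕ Fin m) ℝ} (hE : E.PosSemidef) (hdiag : ∀ i, E i i = 1) :
    (Matrix.of fun s t => E (Sum.inl s) (Sum.inr t)) ∈ quantumCorrelations n m := by
  classical
  obtain ⟨B, hB⟩ := CStarAlgebra.nonneg_iff_eq_star_mul_self.mp hE.nonneg
  have hBT : star B = Bᵀ := by
    rw [star_eq_conjTranspose, conjTranspose_eq_transpose_of_trivial]
  let e : Fin n ⊕ Fin m ≃ Fin (n + m) := finSumFinEquiv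
  let z : Fin n ⊕ Fin m → EuclideanSpace ℝ (Fin (n + m)) := fun i =>
    WithLp.toLp 2 fun k => B (e.symm k) i
  have hz : ∀ i j, inner ℝ (z i) (z j) = E i j := fun i j => by
    rw [EuclideanSpace.inner_toLp_toLp, star_trivial, dotProduct, hB, hBT, Matrix.mul_apply]
    simp only [Matrix.transpose_apply]
    rw [show ∑ x, B x i * B x j = ∑ k, B (e.symm k) i * B (e.symm k) j from
      (e.symm.sum_comp (fun x => B x i * B x j)).symm]
    exact Finset.sum_congr rfl fun k _ => mul_comm _ _
  have hz1 : ∀ i, ‖z i‖ = 1 := fun i => by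
    have h : ‖z i‖ ^ 2 = 1 := by rw [← real_inner_self_eq_norm_sq, hz, hdiag]
    nlinarith [norm_nonneg (z i)]
  exact ⟨fun s => z (Sum.inl s), fun t => z (Sum.inr t), fun s => hz1 _, fun t => hz1 _,
    fun s t => by rw [Matrix.of_apply, hz]⟩

/-- `I + εA ⪰ 0` for a real symmetric `A` once `|ε| · Σ_{p,q}|A_{pq}| ≤ 1`. [folklore] -/
private theorem posSemidef_one_add_smul {N : ℕ} (A : Matrix (Fin N) (Fin N) ℝ) (hA : A.IsSymm)
    (ε : ℝ) (hε : |ε| * ∑ p, ∑ q, |A p q| ≤ 1) :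
    ((1 : Matrix (Fin N) (Fin N) ℝ) + ε • A).PosSemidef := by
  classical
  rw [Matrix.posSemidef_iff_dotProduct_mulVec]
  refine ⟨?_, fun v => ?_⟩
  · unfold Matrix.IsHermitian
    rw [conjTranspose_add, conjTranspose_one, conjTranspose_smul, star_trivial,
      conjTranspose_eq_transpose_of_trivial, hA]
  · set V : ℝ := ∑ p, v p * v p with hVdef
    set S : ℝ := ∑ p, ∑ q, |A p q| with hSdef
    set Qd : ℝ := ∑ p, ∑ q, A p q * (v p * v q) with hQdef
    have hform : star v ⬝ᵥ ((1 + ε • A) *ᵥ v) = V + ε * Qd := by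
      rw [star_trivial, add_mulVec, one_mulVec, smul_mulVec, dotProduct_add, dotProduct_smul,
        smul_eq_mul, hVdef, hQdef]
      congr 1
      congr 1
      simp only [dotProduct, mulVec, Finset.mul_sum]
      exact Finset.sum_congr rfl fun p _ => Finset.sum_congr rfl fun q _ => by ring
    have hV0 : 0 ≤ V := Finset.sum_nonneg fun p _ => mul_self_nonneg (v p)
    have hvp : ∀ p, v p * v p ≤ V := fun p =>
      Finset.single_le_sum (f := fun p => v p * v p) (fun q _ => mul_self_nonneg (v q)) (Finset.mem_univ p)
    have hpq : ∀ p q, |v p| * |v q| ≤ V := fun p q => by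
      have h1 : |v p| * |v q| ≤ (v p * v p + v q * v q) / 2 := by
        have := two_mul_le_add_sq (|v p|) (|v q|)
        rw [← abs_mul_abs_self (v p), ← abs_mul_abs_self (v q)]
        nlinarith
      linarith [hvp p, hvp q]
    have hQ : |Qd| ≤ S * V := by
      calc |Qd| ≤ ∑ p, |∑ q, A p q * (v p * v q)| := Finset.abs_sum_le_sum_abs _ _
        _ ≤ ∑ p, ∑ q, |A p q * (v p * v q)| :=
            Finset.sum_le_sum fun p _ => Finset.abs_sum_le_sum_abs _ _
        _ ≤ ∑ p, ∑ q, |A p q| * V := by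
            refine Finset.sum_le_sum fun p _ => Finset.sum_le_sum fun q _ => ?_
            rw [abs_mul, abs_mul]
            exact mul_le_mul_of_nonneg_left (hpq p q) (abs_nonneg _)
        _ = S * V := by rw [hSdef, Finset.sum_mul]; exact Finset.sum_congr rfl fun p _ => by rw [Finset.sum_mul]
    have h1 : |ε * Qd| ≤ V := by
      rw [abs_mul]
      calc |ε| * |Qd| ≤ |ε| * (S * V) := mul_le_mul_of_nonneg_left hQ (abs_nonneg _)
        _ = (|ε| * S) * V := by ring
        _ ≤ 1 * V := mul_le_mul_of_nonneg_right hε hV0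
        _ = V := one_mul V
    rw [hform]
    linarith [neg_abs_le (ε * Qd)]

/-- A vector orthogonal to a spanning family is zero. [folklore] -/
private theorem eq_zero_of_inner_spanning {N : ℕ} {ι : Type*} (x : ι → EuclideanSpace ℝ (Fin N))
    (hx : Submodule.span ℝ (Set.range x) = ⊤) (a : EuclideanSpace ℝ (Fin N))
    (h : ∀ s, ⟪a, x s⟫ = 0) : a = 0 := by
  have hmem : a ∈ Submodule.span ℝ (Set.range x) := by rw [hx]; exact Submodule.mem_top
  have key : ∀ w ∈ Submodule.span ℝ (Set.range x), ⟪a, w⟫ = 0 := by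
    intro w hw
    induction hw using Submodule.span_induction with
    | mem w hw => obtain ⟨s, rfl⟩ := hw; exact h s
    | zero => exact inner_zero_right _
    | add w w' _ _ hw hw' => rw [inner_add_right, hw, hw', add_zero]
    | smul c w _ hw => rw [real_inner_smul_right, hw, mul_zero]
  have := key a hmem
  rwa [real_inner_self_eq_norm_sq, sq_eq_zero_iff, norm_eq_zero] at this

/-- **GdLL Theorems 3.3 and 3.5, "only if" directions combined** (p09: "If `C` is an extreme point of
`Cor(m,n)` with rank `r`, then by Theorems 3.3 and 3.5 we have" that the Gram vectors `x_s, y_t ∈ ℝ^r`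
of its extension satisfy `binom(r+1,2) = dim span{x_sx_sᵀ, y_ty_tᵀ}`) — the NECESSITY of the Li–Tam
condition assumed in `mem_extremePoints_quantumCorrelations_of_certificate`: for an extreme `C` and a
`C`-system of unit vectors `{x_s}, {y_t} ⊂ ℝ^N` each spanning `ℝ^N`, a symmetric `A` with
`x_sᵀAx_s = 0` and `y_tᵀAy_t = 0` for all `s, t` is zero. Own elementary proof: for `|ε|` small the
matrices `Zᵀ(I ± εA)Z` (`Z` = the system) are psd with unit diagonal, so (by `π`) `C ± ε(x_sᵀAy_t)_{s,t}
∈ Cor(n,m)` with midpoint `C`; extremality gives `x_sᵀAy_t = 0` for all `s, t`, and the two spanning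
families force `A = 0`. [cite: GriblingDelaatLaurent2017, Thm. 3.3 and Thm. 3.5 (p09)] -/
theorem litam_of_mem_extremePoints {N : ℕ} {C : Matrix (Fin n) (Fin m) ℝ}
    (hC : C ∈ Set.extremePoints ℝ (quantumCorrelations n m))
    {x : Fin n → EuclideanSpace ℝ (Fin N)} {y : Fin m → EuclideanSpace ℝ (Fin N)}
    (h : IsCSystem C x y) (hx1 : ∀ s, ‖x s‖ = 1) (hy1 : ∀ t, ‖y t‖ = 1)
    (hx : Submodule.span ℝ (Set.range x) = ⊤) (hy : Submodule.span ℝ (Set.range y) = ⊤)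
    (A : Matrix (Fin N) (Fin N) ℝ) (hA : A.IsSymm)
    (hAx : ∀ s, ∑ p, ∑ q, A p q * (x s p * x s q) = 0)
    (hAy : ∀ t, ∑ p, ∑ q, A p q * (y t p * y t q) = 0) : A = 0 := by
  classical
  -- the system `z = (x, y)` as a matrix and the perturbed Gram matrices `Zᵀ (I + εA) Z`
  let z : Fin n ⊕ Fin m → EuclideanSpace ℝ (Fin N) := Sum.elim x y
  let qA : (Fin n ⊕ Fin m) → (Fin n ⊕ Fin m) → ℝ := fun i j => ∑ p, ∑ q, A p q * (z i p * z j q)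
  have hqdiag : ∀ i, qA i i = 0 := fun i => by
    rcases i with s | t
    · exact hAx s
    · exact hAy t
  have hzz : ∀ i, ⟪z i, z i⟫ = 1 := fun i => by
    rw [real_inner_self_eq_norm_sq]
    rcases i with s | t
    · show ‖x s‖ ^ 2 = 1; rw [hx1, one_pow]
    · show ‖y t‖ ^ 2 = 1; rw [hy1, one_pow]
  let Zm : Matrix (Fin N) (Fin n ⊕ Fin m) ℝ := Matrix.of fun p i => z i p
  let E : ℝ → Matrix (Fin n ⊕ Fin m) (Fin n ⊕ Fin m) ℝ := fun ε => Zmᵀ * (1 + ε • A) * Zm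
  have hinner : ∀ i j, ⟪z i, z j⟫ = ∑ p, z i p * z j p := fun i j => by
    rw [EuclideanSpace.inner_eq_star_dotProduct, star_trivial, dotProduct]
    exact Finset.sum_congr rfl fun p _ => mul_comm _ _
  have hE : ∀ ε i j, E ε i j = ⟪z i, z j⟫ + ε * qA i j := by
    intro ε i j
    have h1 : E ε i j = ∑ p, ∑ q, z i p * (1 + ε • A) p q * z j q := by
      simp only [E, Zm, Matrix.mul_apply, Matrix.transpose_apply, Matrix.of_apply, Finset.sum_mul]
      rw [Finset.sum_comm]
    rw [h1]
    simp only [Matrix.add_apply, Matrix.one_apply, Matrix.smul_apply, smul_eq_mul, mul_add, add_mul,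
      Finset.sum_add_distrib]
    congr 1
    · simp only [mul_ite, mul_one, mul_zero, ite_mul, zero_mul, Finset.sum_ite_eq, Finset.mem_univ,
        if_true]
      rw [hinner]
    · simp only [qA, Finset.mul_sum]
      exact Finset.sum_congr rfl fun p _ => Finset.sum_congr rfl fun q _ => by ring
  -- `ε` small enough
  set S : ℝ := ∑ p, ∑ q, |A p q| with hSdef
  have hS0 : 0 ≤ S := Finset.sum_nonneg fun p _ => Finset.sum_nonneg fun q _ => abs_nonneg _
  set ε : ℝ := 1 / (1 + S) with hεdef
  have hεpos : 0 < ε := by rw [hεdef]; positivity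
  have hεS : ∀ δ : ℝ, |δ| = ε → |δ| * S ≤ 1 := fun δ hδ => by
    rw [hδ, hεdef, div_mul_eq_mul_div, one_mul, div_le_one (by positivity)]
    linarith
  have hpsd : ∀ δ : ℝ, |δ| = ε → (E δ).PosSemidef := fun δ hδ => by
    have h1 := (posSemidef_one_add_smul A hA δ (hεS δ hδ)).conjTranspose_mul_mul_same Zm
    rwa [conjTranspose_eq_transpose_of_trivial] at h1
  have hdiagE : ∀ δ i, E δ i i = 1 := fun δ i => by rw [hE, hzz, hqdiag, mul_zero, add_zero]
  -- the two perturbed correlations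
  have hmem : ∀ δ : ℝ, |δ| = ε →
      (Matrix.of fun s t => C s t + δ * qA (Sum.inl s) (Sum.inr t)) ∈ quantumCorrelations n m := by
    intro δ hδ
    have hm := offDiag_mem_quantumCorrelations_of_posSemidef (hpsd δ hδ) (hdiagE δ)
    have heq : (Matrix.of fun s t => E δ (Sum.inl s) (Sum.inr t)) =
        Matrix.of fun s t => C s t + δ * qA (Sum.inl s) (Sum.inr t) := by
      ext s t
      rw [Matrix.of_apply, Matrix.of_apply, hE, h.2.2 s t]
      rfl
    rwa [heq] at hm
  have hseg : C ∈ openSegment ℝ (Matrix.of fun s t => C s t + ε * qA (Sum.inl s) (Sum.inr t))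
      (Matrix.of fun s t => C s t + (-ε) * qA (Sum.inl s) (Sum.inr t)) := by
    refine ⟨1 / 2, 1 / 2, by norm_num, by norm_num, by norm_num, ?_⟩
    ext s t
    simp only [Matrix.add_apply, Matrix.smul_apply, Matrix.of_apply, smul_eq_mul]
    ring
  have hext := hC.2 (hmem ε (abs_of_pos hεpos)) (hmem (-ε) (by rw [abs_neg, abs_of_pos hεpos])) hseg
  -- hence `x_sᵀ A y_t = 0`
  have hcross : ∀ s t, qA (Sum.inl s) (Sum.inr t) = 0 := fun s t => by
    have h1 := congrFun (congrFun hext s) t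
    rw [Matrix.of_apply] at h1
    have h2 : ε * qA (Sum.inl s) (Sum.inr t) = 0 := by linarith
    exact (mul_eq_zero.mp h2).resolve_left hεpos.ne'
  -- `A y_t ⊥ x_s` for all `s`, so `A y_t = 0`; then the rows of `A` are `⊥ y_t`, so `A = 0`
  have hAy0 : ∀ t p, ∑ q, A p q * y t q = 0 := by
    intro t
    let a : EuclideanSpace ℝ (Fin N) := WithLp.toLp 2 fun p => ∑ q, A p q * y t q
    have ha : a = 0 := eq_zero_of_inner_spanning x hx a fun s => by
      rw [← hcross s t]
      simp only [qA, z, Sum.elim_inl, Sum.elim_inr, a, EuclideanSpace.inner_eq_star_dotProduct,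
        star_trivial, dotProduct, Finset.mul_sum]
      exact Finset.sum_congr rfl fun p _ => Finset.sum_congr rfl fun q _ => by ring
    intro p
    have := congrArg (fun w : EuclideanSpace ℝ (Fin N) => w p) ha
    simpa [a] using this
  ext p q
  rw [Matrix.zero_apply]
  let r : EuclideanSpace ℝ (Fin N) := WithLp.toLp 2 fun q => A p q
  have hr : r = 0 := eq_zero_of_inner_spanning y hy r fun t => by
    rw [← hAy0 t p]
    simp only [r, EuclideanSpace.inner_eq_star_dotProduct, star_trivial, dotProduct]
    exact Finset.sum_congr rfl fun q _ => mul_comm _ _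
  have := congrArg (fun w : EuclideanSpace ℝ (Fin N) => w q) hr
  simpa [r] using this

/-- **Tsirelson's weak bound** (p09, verbatim: "If `C` is an extreme point of `Cor(m,n)` with rank
`r`, then by Theorems 3.3 and 3.5 we have `binom(r+1,2) ≤ m + n`"; Theorem 3.5's "in particular"),
for `n, m ≥ 1`. Proof: a `C`-system of unit vectors in `ℝ^{τ_C}`, `τ_C = rank C`
(`finrank_span_eq_rank_of_mem_extremePoints`), spanning on both sides (Lemma 12); by
`litam_of_mem_extremePoints` the linear map `A ↦ (z_iᵀAz_i)_i` from symmetric `r × r` matrices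
(dimension `binom(r+1,2)`) to `ℝ^{n+m}` is injective. (The sharper bound `≤ m+n−1`, Corollary 3.10,
is `GriblingDelaatLaurent2017_cor310` below.) [cite: GriblingDelaatLaurent2017, §3.2 (p09), Thm. 3.5 (p09)] -/
theorem choose_rank_succ_le_of_mem_extremePoints {C : Matrix (Fin n) (Fin m) ℝ} (hn : 0 < n)
    (hm : 0 < m) (hC : C ∈ Set.extremePoints ℝ (quantumCorrelations n m)) :
    (C.rank + 1).choose 2 ≤ n + m := by
  classical
  -- a unit `C`-system in `ℝ^{rank C}` spanning on both sides
  obtain ⟨hspan, -⟩ := Tsirelson1987_lemma12_holds n m C hn hm hC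
  obtain ⟨u0, v0, hu0, hv0, hCuv⟩ := hC.1
  have hsys0 : IsCSystem C u0 v0 := ⟨fun s => (hu0 s).le, fun t => (hv0 t).le, hCuv⟩
  let W : Submodule ℝ (EuclideanSpace ℝ (Fin (n + m))) := Submodule.span ℝ (Set.range u0)
  have hW : Module.finrank ℝ W = C.rank := finrank_span_eq_rank_of_mem_extremePoints hn hm hC hsys0
  let φ : W ≃ₗᵢ[ℝ] EuclideanSpace ℝ (Fin C.rank) :=
    ((stdOrthonormalBasis ℝ W).reindex (finCongr hW)).repr
  have huW : ∀ s, u0 s ∈ W := fun s => Submodule.subset_span ⟨s, rfl⟩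
  have hvW : ∀ t, v0 t ∈ W := fun t => by
    show v0 t ∈ Submodule.span ℝ (Set.range u0)
    rw [hspan _ u0 v0 hsys0]
    exact Submodule.subset_span ⟨t, rfl⟩
  let u : Fin n → EuclideanSpace ℝ (Fin C.rank) := fun s => φ ⟨u0 s, huW s⟩
  let v : Fin m → EuclideanSpace ℝ (Fin C.rank) := fun t => φ ⟨v0 t, hvW t⟩
  have hu1 : ∀ s, ‖u s‖ = 1 := fun s => by simp only [u, LinearIsometryEquiv.norm_map]; exact hu0 s
  have hv1 : ∀ t, ‖v t‖ = 1 := fun t => by simp only [v, LinearIsometryEquiv.norm_map]; exact hv0 t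
  have hsys : IsCSystem C u v := by
    refine ⟨fun s => (hu1 s).le, fun t => (hv1 t).le, fun s t => ?_⟩
    simp only [u, v, LinearIsometryEquiv.inner_map_map, Submodule.coe_inner]
    exact hCuv s t
  have hspan_u : Submodule.span ℝ (Set.range u) = ⊤ := by
    apply Submodule.eq_top_of_finrank_eq
    rw [finrank_euclideanSpace_fin]
    exact finrank_span_eq_rank_of_mem_extremePoints hn hm hC hsys
  have hspan_v : Submodule.span ℝ (Set.range v) = ⊤ := by
    rw [← hspan _ u v hsys]; exact hspan_u
  -- symmetric matrices from upper-triangular coefficient vectors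
  let T := {p : Fin C.rank × Fin C.rank // p.1 ≤ p.2}
  let symOf : (T → ℝ) → Matrix (Fin C.rank) (Fin C.rank) ℝ := fun a => Matrix.of fun p q =>
    if hpq : p ≤ q then a ⟨(p, q), hpq⟩ else a ⟨(q, p), le_of_lt (not_le.mp hpq)⟩
  have hsymOf_symm : ∀ a, (symOf a).IsSymm := fun a => by
    ext p q
    simp only [symOf, Matrix.transpose_apply, Matrix.of_apply]
    by_cases hpq : p ≤ q
    · by_cases hqp : q ≤ p
      · have : p = q := le_antisymm hpq hqp
        subst this; rfl
      · rw [dif_pos hpq, dif_neg hqp]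
    · have hqp : q ≤ p := le_of_lt (not_le.mp hpq)
      rw [dif_neg hpq, dif_pos hqp]
  let z : Fin n ⊕ Fin m → EuclideanSpace ℝ (Fin C.rank) := Sum.elim u v
  let Φ : (T → ℝ) →ₗ[ℝ] (Fin n ⊕ Fin m → ℝ) :=
    { toFun := fun a i => ∑ p, ∑ q, symOf a p q * (z i p * z i q)
      map_add' := fun a b => by
        funext i
        simp only [Pi.add_apply, ← Finset.sum_add_distrib]
        refine Finset.sum_congr rfl fun p _ => Finset.sum_congr rfl fun q _ => ?_
        simp only [symOf, Matrix.of_apply]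
        split_ifs <;> simp only [Pi.add_apply] <;> ring
      map_smul' := fun c a => by
        funext i
        simp only [Pi.smul_apply, smul_eq_mul, RingHom.id_apply, Finset.mul_sum]
        refine Finset.sum_congr rfl fun p _ => Finset.sum_congr rfl fun q _ => ?_
        simp only [symOf, Matrix.of_apply]
        split_ifs <;> simp only [Pi.smul_apply, smul_eq_mul] <;> ring }
  have hΦinj : Function.Injective Φ := by
    rw [← LinearMap.ker_eq_bot, LinearMap.ker_eq_bot']
    intro a ha
    have hA0 : symOf a = 0 := by
      refine litam_of_mem_extremePoints hC hsys hu1 hv1 hspan_u hspan_v (symOf a) (hsymOf_symm a)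
        (fun s => ?_) (fun t => ?_)
      · have h1 := congrFun ha (Sum.inl s)
        simpa [Φ, z] using h1
      · have h1 := congrFun ha (Sum.inr t)
        simpa [Φ, z] using h1
    funext ⟨⟨p, q⟩, hpq⟩
    have := congrFun (congrFun hA0 p) q
    simp only [symOf, Matrix.of_apply, Matrix.zero_apply, dif_pos hpq] at this
    exact this
  have hle := LinearMap.finrank_le_finrank_of_injective hΦinj
  rw [Module.finrank_fintype_fun_eq_card, Module.finrank_fintype_fun_eq_card, Fintype.card_sum,
    Fintype.card_fin, Fintype.card_fin] at hle
  have hcard : Fintype.card T = (C.rank + 1).choose 2 := by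
    rw [← Fintype.card_congr (Sym2.sortEquiv (α := Fin C.rank)), Sym2.card, Fintype.card_fin]
  rwa [hcard] at hle

end LiTamNecessity

/-! ### Tsirelson's identity for extreme correlations (Theorem 3.9 (i)) and Tsirelson's sharp bound
(Corollary 3.10) (appended) -/

section TsirelsonIdentity

open Matrix Finset
open scoped RealInnerProductSpace MatrixOrder

variable {n m : ℕ}

/-- `Tr(E_{ij}X) = X_{ji}`. [folklore] -/
private theorem trace_single_mul {ι : Type*} [Fintype ι] [DecidableEq ι] (i j : ι)
    (X : Matrix ι ι ℝ) : (Matrix.single i j (1 : ℝ) * X).trace = X j i := by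
  rw [Matrix.trace, Finset.sum_eq_single i]
  · simp
  · intro p _ hp; simp [hp]
  · intro h; exact absurd (Finset.mem_univ i) h

/-- A vector of a real inner product space expanded against itself: if `a = Σ_k c_k w_k` (given as the
two pieces `c₀ • w₀ + Σ_t c_t w_t`) is orthogonal to `w₀` and to every `w_t`, then `a = 0`. [folklore] -/
private theorem eq_zero_of_inner_pieces {F : Type*} [NormedAddCommGroup F] [InnerProductSpace ℝ F]
    {κ : Type*} [Fintype κ] (c₀ : ℝ) (w₀ : F) (c : κ → ℝ) (w : κ → F)
    (h₀ : ⟪c₀ • w₀ + ∑ t, c t • w t, w₀⟫ = 0) (h : ∀ t, ⟪c₀ • w₀ + ∑ t, c t • w t, w t⟫ = 0) :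
    c₀ • w₀ + ∑ t, c t • w t = 0 := by
  set a := c₀ • w₀ + ∑ t, c t • w t with ha
  have : ⟪a, a⟫ = 0 := by
    conv_lhs => arg 2; rw [ha]
    rw [inner_add_right, real_inner_smul_right, inner_sum, h₀, mul_zero, zero_add]
    exact Finset.sum_eq_zero fun t _ => by rw [real_inner_smul_right, h t, mul_zero]
  exact inner_self_eq_zero.mp this

/-- **GdLL Theorem 3.9 (i) — Tsirelson's identity for extreme bipartite correlations** (p10, after
[Tsirelson], verbatim: "Let `C ∈ Cor(m,n)`, let `{x_s}`, `{y_t}` be a `C`-system spanning `ℝ^r`, and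
let `E = Gram(x_1,…,x_m,y_1,…,y_n) ∈ 𝓔_{m+n}`. (i) If `C` is an extreme point of `Cor(m,n)`, then
there exist nonnegative scalars `λ_1,…,λ_m, μ_1,…,μ_n`, not all equal to zero, such that
`Σ_{s=1}^m λ_s x_sx_sᵀ = Σ_{t=1}^n μ_t y_ty_tᵀ`."). Typed for an extreme `C ∈ Cor(n,m)` (`n, m ≥ 1`,
the standing Bell-scenario assumption) and ANY `C`-system `(x, y) ⊂ ℝ^N` (PSVW Def. 5; the
spanning hypothesis is not needed for (i) and is dropped), the dyadic identity stated entrywise.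
Proof as printed: `E = Gram(x ⊔ y)` is the only feasible point of the program
(P) `{X ⪰ 0 : X_kk = E_kk, X_st = C_st}` (uniqueness of the extension,
`gram_sumElim_eq_of_mem_extremePoints`) and is singular (`span{x_s} = span{y_t}`, Lemma 12), so (P)
has no positive definite feasible point; the theorem of the alternative
(`GriblingDelaatLaurent2017_lemma38`) gives `Ω = (Diag λ, W; Wᵀ, Diag μ) ⪰ 0`, `Ω ≠ 0`, `ΩE = 0`,
whence `λ_s x_s + Σ_t W_st y_t = 0`, `μ_t y_t + Σ_s W_st x_s = 0`, and summing `x_s(·)ᵀ`, `(·)y_tᵀ`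
gives the identity. Part (ii) (GdLL: "we omit the details") is not formalized.
[cite: GriblingDelaatLaurent2017, Thm. 3.9 (i) (p10)] -/
theorem GriblingDelaatLaurent2017_thm39i {N : ℕ} {C : Matrix (Fin n) (Fin m) ℝ} (hn : 0 < n)
    (hm : 0 < m) (hC : C ∈ Set.extremePoints ℝ (quantumCorrelations n m))
    {x : Fin n → EuclideanSpace ℝ (Fin N)} {y : Fin m → EuclideanSpace ℝ (Fin N)}
    (h : IsCSystem C x y) :
    ∃ (lam : Fin n → ℝ) (μ : Fin m → ℝ), (∀ s, 0 ≤ lam s) ∧ (∀ t, 0 ≤ μ t) ∧ ¬(lam = 0 ∧ μ = 0) ∧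
      ∀ p q : Fin N, ∑ s, lam s * (x s p * x s q) = ∑ t, μ t * (y t p * y t q) := by
  classical
  -- the system `z = x ⊔ y` and its Gram matrix `E`
  let z : Fin n ⊕ Fin m → EuclideanSpace ℝ (Fin N) := Sum.elim x y
  let E : Matrix (Fin n ⊕ Fin m) (Fin n ⊕ Fin m) ℝ := Matrix.gram ℝ z
  have hE : ∀ i j, E i j = ⟪z i, z j⟫ := fun i j => Matrix.gram_apply z i j
  have hEpsd : E.PosSemidef := Matrix.posSemidef_gram ℝ z
  have hz1 : ∀ i, ‖z i‖ ≤ 1 := fun i => by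
    cases i with
    | inl s => exact h.1 s
    | inr t => exact h.2.1 t
  -- the constraints of program (P): the diagonal entries and the bipartite block
  let A : (Fin n ⊕ Fin m) ⊕ (Fin n × Fin m) → Matrix (Fin n ⊕ Fin m) (Fin n ⊕ Fin m) ℝ :=
    Sum.elim (fun i => Matrix.single i i (1 : ℝ)) fun st =>
      Matrix.single (Sum.inl st.1) (Sum.inr st.2) (1 : ℝ) + Matrix.single (Sum.inr st.2) (Sum.inl st.1) 1
  have hA : ∀ j, (A j).IsSymm := fun j => by
    cases j with
    | inl i => exact Matrix.transpose_single i i (1 : ℝ)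
    | inr st =>
      show (Matrix.single (Sum.inl st.1) (Sum.inr st.2) (1 : ℝ) +
          Matrix.single (Sum.inr st.2) (Sum.inl st.1) 1)ᵀ =
        Matrix.single (Sum.inl st.1) (Sum.inr st.2) (1 : ℝ) + Matrix.single (Sum.inr st.2) (Sum.inl st.1) 1
      rw [Matrix.transpose_add, Matrix.transpose_single, Matrix.transpose_single, add_comm]
  have htrD : ∀ (i : Fin n ⊕ Fin m) (X : Matrix (Fin n ⊕ Fin m) (Fin n ⊕ Fin m) ℝ),
      (A (Sum.inl i) * X).trace = X i i := fun i X => trace_single_mul i i X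
  have htrO : ∀ (s : Fin n) (t : Fin m) (X : Matrix (Fin n ⊕ Fin m) (Fin n ⊕ Fin m) ℝ),
      (A (Sum.inr (s, t)) * X).trace = X (Sum.inr t) (Sum.inl s) + X (Sum.inl s) (Sum.inr t) :=
    fun s t X => by
      show ((Matrix.single (Sum.inl s) (Sum.inr t) (1 : ℝ) +
          Matrix.single (Sum.inr t) (Sum.inl s) 1) * X).trace = _
      rw [Matrix.add_mul, Matrix.trace_add, trace_single_mul, trace_single_mul]
  let b : (Fin n ⊕ Fin m) ⊕ (Fin n × Fin m) → ℝ := fun j => (A j * E).trace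
  have hfeas : ∀ j, (A j * E).trace = b j := fun j => rfl
  -- Lemma 12: the `y_t` lie in the span of the `x_s`, so `z` is linearly dependent
  have hdep : ¬ LinearIndependent ℝ z := by
    intro hli
    have hspan := (Tsirelson1987_lemma12_holds n m C hn hm hC).1 N x y h
    let t₀ : Fin m := ⟨0, hm⟩
    have hyt : y t₀ ∈ Submodule.span ℝ (Set.range x) := by
      rw [hspan]; exact Submodule.subset_span ⟨t₀, rfl⟩
    obtain ⟨c, hc⟩ := (Submodule.mem_span_range_iff_exists_fun ℝ).mp hyt
    let g : Fin n ⊕ Fin m → ℝ := Sum.elim c fun t => if t = t₀ then -1 else 0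
    have hg : ∑ i, g i • z i = 0 := by
      rw [Fintype.sum_sum_type]
      simp only [g, z, Sum.elim_inl, Sum.elim_inr, hc, ite_smul, neg_smul, one_smul, zero_smul,
        Finset.sum_ite_eq', Finset.mem_univ, if_true, add_neg_cancel]
    have := Fintype.linearIndependent_iff.mp hli g hg (Sum.inr t₀)
    simp [g, t₀] at this
  -- (P) has no positive definite feasible point: such an `X` would be a Gram matrix of a
  -- `C`-system, hence equal to `E` (uniqueness of the extension), but `E` is singular
  have hno : ¬ ∃ X : Matrix (Fin n ⊕ Fin m) (Fin n ⊕ Fin m) ℝ,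
      X.PosDef ∧ ∀ j, (A j * X).trace = b j := by
    rintro ⟨X, hX, hXf⟩
    -- `X = Gram(w)` for vectors `w_i ∈ ℝ^{n+m}`
    obtain ⟨B, hB⟩ := CStarAlgebra.nonneg_iff_eq_star_mul_self.mp hX.posSemidef.nonneg
    have hBT : star B = Bᵀ := by
      rw [star_eq_conjTranspose, conjTranspose_eq_transpose_of_trivial]
    let e : Fin n ⊕ Fin m ≃ Fin (n + m) := finSumFinEquiv
    let w : Fin n ⊕ Fin m → EuclideanSpace ℝ (Fin (n + m)) := fun i =>
      WithLp.toLp 2 fun k => B (e.symm k) i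
    have hw : ∀ i j, ⟪w i, w j⟫ = X i j := fun i j => by
      rw [EuclideanSpace.inner_toLp_toLp, star_trivial, dotProduct, hB, hBT, Matrix.mul_apply]
      simp only [Matrix.transpose_apply]
      rw [show ∑ x, B x i * B x j = ∑ k, B (e.symm k) i * B (e.symm k) j from
        (e.symm.sum_comp (fun x => B x i * B x j)).symm]
      exact Finset.sum_congr rfl fun k _ => mul_comm _ _
    have hXsymm : ∀ i j, X j i = X i j := fun i j => by
      simpa using hX.1.apply i j
    have hdiag : ∀ i, X i i = E i i := fun i => by
      have := hXf (Sum.inl i)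
      rwa [htrD, show b (Sum.inl i) = E i i from htrD i E] at this
    have hoff : ∀ s t, X (Sum.inl s) (Sum.inr t) = C s t := fun s t => by
      have h1 := hXf (Sum.inr (s, t))
      rw [htrO, show b (Sum.inr (s, t)) = E (Sum.inr t) (Sum.inl s) + E (Sum.inl s) (Sum.inr t) from
        htrO s t E, hXsymm, hE, hE] at h1
      have h2 : ⟪z (Sum.inr t), z (Sum.inl s)⟫ = C s t := by
        simp only [z, Sum.elim_inl, Sum.elim_inr]; rw [real_inner_comm, h.2.2]
      have h3 : ⟪z (Sum.inl s), z (Sum.inr t)⟫ = C s t := by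
        simp only [z, Sum.elim_inl, Sum.elim_inr]; rw [h.2.2]
      linarith
    have hwn : ∀ i, ‖w i‖ ≤ 1 := fun i => by
      have h1 : ‖w i‖ ^ 2 ≤ 1 := by
        rw [← real_inner_self_eq_norm_sq, hw, hdiag, hE, real_inner_self_eq_norm_sq]
        have := hz1 i
        nlinarith [norm_nonneg (z i)]
      nlinarith [norm_nonneg (w i)]
    have hsys' : IsCSystem C (fun s => w (Sum.inl s)) (fun t => w (Sum.inr t)) :=
      ⟨fun s => hwn _, fun t => hwn _, fun s t => by rw [hw, hoff]⟩
    have hXE : X = E := by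
      have hg := gram_sumElim_eq_of_mem_extremePoints hn hm hC hsys' h
      ext i j
      have h1 := congrFun (congrFun hg i) j
      rw [Matrix.gram_apply, Matrix.gram_apply] at h1
      have h2 : ∀ k, Sum.elim (fun s => w (Sum.inl s)) (fun t => w (Sum.inr t)) k = w k := fun k => by
        cases k <;> rfl
      rw [h2, h2] at h1
      rw [← hw, h1, hE]
    rw [hXE] at hX
    exact hdep (Matrix.posDef_gram_iff_linearIndependent.mp hX)
  -- the theorem of the alternative
  obtain ⟨yv, hΩpsd, hΩne, hΩE⟩ := GriblingDelaatLaurent2017_lemma38 A hA b E hEpsd hfeas hno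
  set Ω := ∑ j, yv j • A j with hΩdef
  -- the zero pattern of `Ω` (support inside `K_{n,m}` plus the diagonal)
  have hΩentry : ∀ p q, Ω p q = ∑ j, yv j * A j p q := fun p q => by
    rw [hΩdef, Matrix.sum_apply]
    exact Finset.sum_congr rfl fun j _ => by rw [Matrix.smul_apply, smul_eq_mul]
  have hΩxx : ∀ s s', s ≠ s' → Ω (Sum.inl s) (Sum.inl s') = 0 := fun s s' hss => by
    rw [hΩentry]
    refine Finset.sum_eq_zero fun j _ => ?_
    cases j with
    | inl i =>
      have : Matrix.single i i (1 : ℝ) (Sum.inl s) (Sum.inl s') = 0 :=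
        Matrix.single_apply_of_ne _ _ _ _ _ fun ⟨h1, h2⟩ => hss (Sum.inl_injective (h1.symm.trans h2))
      simp only [A, Sum.elim_inl, this, mul_zero]
    | inr st =>
      simp only [A, Sum.elim_inr, Matrix.add_apply]
      rw [Matrix.single_apply_of_ne _ _ _ _ _ (by simp), Matrix.single_apply_of_ne _ _ _ _ _ (by simp)]
      ring
  have hΩyy : ∀ t t', t ≠ t' → Ω (Sum.inr t) (Sum.inr t') = 0 := fun t t' htt => by
    rw [hΩentry]
    refine Finset.sum_eq_zero fun j _ => ?_
    cases j with
    | inl i =>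
      have : Matrix.single i i (1 : ℝ) (Sum.inr t) (Sum.inr t') = 0 :=
        Matrix.single_apply_of_ne _ _ _ _ _ fun ⟨h1, h2⟩ => htt (Sum.inr_injective (h1.symm.trans h2))
      simp only [A, Sum.elim_inl, this, mul_zero]
    | inr st =>
      simp only [A, Sum.elim_inr, Matrix.add_apply]
      rw [Matrix.single_apply_of_ne _ _ _ _ _ (by simp), Matrix.single_apply_of_ne _ _ _ _ _ (by simp)]
      ring
  have hΩsymm : ∀ p q, Ω q p = Ω p q := fun p q => by simpa using hΩpsd.1.apply p q
  -- the multipliers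
  let lam : Fin n → ℝ := fun s => Ω (Sum.inl s) (Sum.inl s)
  let μ : Fin m → ℝ := fun t => Ω (Sum.inr t) (Sum.inr t)
  let W : Fin n → Fin m → ℝ := fun s t => Ω (Sum.inl s) (Sum.inr t)
  -- rows of `ΩE = 0`
  have hrow : ∀ i j, ∑ k, Ω i k * ⟪z k, z j⟫ = 0 := fun i j => by
    have := congrFun (congrFun hΩE i) j
    rw [Matrix.mul_apply, Matrix.zero_apply] at this
    simpa only [hE] using this
  have ha : ∀ s, lam s • x s + ∑ t, W s t • y t = 0 := fun s => by
    have key : ∀ j, ⟪lam s • x s + ∑ t, W s t • y t, z j⟫ = 0 := fun j => by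
      rw [← hrow (Sum.inl s) j, Fintype.sum_sum_type, inner_add_left, real_inner_smul_left, sum_inner,
        Finset.sum_eq_single s (fun s' _ hs' => by rw [hΩxx s s' (Ne.symm hs'), zero_mul])
          (fun hs => absurd (Finset.mem_univ s) hs)]
      simp only [z, Sum.elim_inl, Sum.elim_inr, real_inner_smul_left, lam, W]
    exact eq_zero_of_inner_pieces (lam s) (x s) (W s) y (key (Sum.inl s)) fun t => key (Sum.inr t)
  have hb : ∀ t, μ t • y t + ∑ s, W s t • x s = 0 := fun t => by
    have key : ∀ j, ⟪μ t • y t + ∑ s, W s t • x s, z j⟫ = 0 := fun j => by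
      rw [← hrow (Sum.inr t) j, Fintype.sum_sum_type, inner_add_left, real_inner_smul_left, sum_inner,
        Finset.sum_eq_single t (fun t' _ ht' => by rw [hΩyy t t' (Ne.symm ht'), zero_mul])
          (fun ht => absurd (Finset.mem_univ t) ht), add_comm]
      simp only [z, Sum.elim_inl, Sum.elim_inr, real_inner_smul_left, μ, W, hΩsymm (Sum.inl _) (Sum.inr t)]
    exact eq_zero_of_inner_pieces (μ t) (y t) (fun s => W s t) x (key (Sum.inr t))
      fun s => key (Sum.inl s)
  -- coordinates
  have hap : ∀ s p, lam s * x s p = -∑ t, W s t * y t p := fun s p => by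
    have h1 := congrArg (fun a : EuclideanSpace ℝ (Fin N) => ⟪EuclideanSpace.single p (1 : ℝ), a⟫) (ha s)
    simp only [inner_zero_right, inner_add_right, real_inner_smul_right, inner_sum,
      inner_single_one_left] at h1
    linarith
  have hbp : ∀ t q, μ t * y t q = -∑ s, W s t * x s q := fun t q => by
    have h1 := congrArg (fun a : EuclideanSpace ℝ (Fin N) => ⟪EuclideanSpace.single q (1 : ℝ), a⟫) (hb t)
    simp only [inner_zero_right, inner_add_right, real_inner_smul_right, inner_sum,
      inner_single_one_left] at h1
    linarith
  refine ⟨lam, μ, fun s => hΩpsd.diag_nonneg, fun t => hΩpsd.diag_nonneg, fun ⟨hl0, hμ0⟩ => ?_,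
    fun p q => ?_⟩
  · -- `λ = μ = 0` would force `Tr Ω = 0`, i.e. `Ω = 0`
    apply hΩne
    rw [← hΩpsd.trace_eq_zero_iff, Matrix.trace, Fintype.sum_sum_type]
    simp only [Matrix.diag_apply]
    have h1 : ∑ s, Ω (Sum.inl s) (Sum.inl s) = 0 :=
      Finset.sum_eq_zero fun s _ => by have := congrFun hl0 s; simpa [lam] using this
    have h2 : ∑ t, Ω (Sum.inr t) (Sum.inr t) = 0 :=
      Finset.sum_eq_zero fun t _ => by have := congrFun hμ0 t; simpa [μ] using this
    rw [h1, h2, add_zero]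
  · calc ∑ s, lam s * (x s p * x s q) = ∑ s, (lam s * x s p) * x s q :=
          Finset.sum_congr rfl fun s _ => by ring
      _ = ∑ s, (-∑ t, W s t * y t p) * x s q := Finset.sum_congr rfl fun s _ => by rw [hap]
      _ = -∑ s, ∑ t, W s t * y t p * x s q := by
          rw [← Finset.sum_neg_distrib]
          exact Finset.sum_congr rfl fun s _ => by rw [neg_mul, Finset.sum_mul]
      _ = -∑ t, ∑ s, W s t * y t p * x s q := by rw [Finset.sum_comm]
      _ = ∑ t, y t p * (-∑ s, W s t * x s q) := by
          rw [← Finset.sum_neg_distrib]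
          exact Finset.sum_congr rfl fun t _ => by
            rw [mul_neg, Finset.mul_sum, ← Finset.sum_neg_distrib, ← Finset.sum_neg_distrib]
            exact Finset.sum_congr rfl fun s _ => by ring
      _ = ∑ t, y t p * (μ t * y t q) := Finset.sum_congr rfl fun t _ => by rw [hbp]
      _ = ∑ t, μ t * (y t p * y t q) := Finset.sum_congr rfl fun t _ => by ring

/-- **GdLL Corollary 3.10 — Tsirelson's bound** (p10, after [Tsirelson], verbatim: "If `C` is an
extreme point of `Cor(m,n)`, then `binom(rank(C)+1, 2) ≤ n+m−1`."), for `n, m ≥ 1` (the standing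
Bell-scenario assumption); sharpens the weak bound `choose_rank_succ_le_of_mem_extremePoints`
(`≤ n+m`). Proof as printed: for a unit `C`-system `z = u ⊔ v ⊂ ℝ^r`, `r = rank C`, spanning on both
sides, the `n+m` dyads `z_iz_iᵀ` span `𝒮^r` (Li–Tam necessity `litam_of_mem_extremePoints`, in the
dual form: `A ↦ (z_iᵀAz_i)_i` is injective on `𝒮^r`) and satisfy the nontrivial linear relation
`Σ_s λ_s u_su_sᵀ − Σ_t μ_t v_tv_tᵀ = 0` of Theorem 3.9 (i) (`GriblingDelaatLaurent2017_thm39i`); so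
`(A, c) ↦ (z_iᵀAz_i)_i + c·(λ, −μ)` is injective on `𝒮^r × ℝ`, i.e. `binom(r+1,2) + 1 ≤ n + m`.
[cite: GriblingDelaatLaurent2017, Cor. 3.10 (p10)] -/
theorem GriblingDelaatLaurent2017_cor310 {C : Matrix (Fin n) (Fin m) ℝ} (hn : 0 < n) (hm : 0 < m)
    (hC : C ∈ Set.extremePoints ℝ (quantumCorrelations n m)) :
    (C.rank + 1).choose 2 ≤ n + m - 1 := by
  classical
  -- a unit `C`-system in `ℝ^{rank C}` spanning on both sides
  obtain ⟨hspan, -⟩ := Tsirelson1987_lemma12_holds n m C hn hm hC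
  obtain ⟨u0, v0, hu0, hv0, hCuv⟩ := hC.1
  have hsys0 : IsCSystem C u0 v0 := ⟨fun s => (hu0 s).le, fun t => (hv0 t).le, hCuv⟩
  let W : Submodule ℝ (EuclideanSpace ℝ (Fin (n + m))) := Submodule.span ℝ (Set.range u0)
  have hW : Module.finrank ℝ W = C.rank := finrank_span_eq_rank_of_mem_extremePoints hn hm hC hsys0
  let φ : W ≃ₗᵢ[ℝ] EuclideanSpace ℝ (Fin C.rank) :=
    ((stdOrthonormalBasis ℝ W).reindex (finCongr hW)).repr
  have huW : ∀ s, u0 s ∈ W := fun s => Submodule.subset_span ⟨s, rfl⟩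
  have hvW : ∀ t, v0 t ∈ W := fun t => by
    show v0 t ∈ Submodule.span ℝ (Set.range u0)
    rw [hspan _ u0 v0 hsys0]
    exact Submodule.subset_span ⟨t, rfl⟩
  let u : Fin n → EuclideanSpace ℝ (Fin C.rank) := fun s => φ ⟨u0 s, huW s⟩
  let v : Fin m → EuclideanSpace ℝ (Fin C.rank) := fun t => φ ⟨v0 t, hvW t⟩
  have hu1 : ∀ s, ‖u s‖ = 1 := fun s => by simp only [u, LinearIsometryEquiv.norm_map]; exact hu0 s
  have hv1 : ∀ t, ‖v t‖ = 1 := fun t => by simp only [v, LinearIsometryEquiv.norm_map]; exact hv0 t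
  have hsys : IsCSystem C u v := by
    refine ⟨fun s => (hu1 s).le, fun t => (hv1 t).le, fun s t => ?_⟩
    simp only [u, v, LinearIsometryEquiv.inner_map_map, Submodule.coe_inner]
    exact hCuv s t
  have hspan_u : Submodule.span ℝ (Set.range u) = ⊤ := by
    apply Submodule.eq_top_of_finrank_eq
    rw [finrank_euclideanSpace_fin]
    exact finrank_span_eq_rank_of_mem_extremePoints hn hm hC hsys
  have hspan_v : Submodule.span ℝ (Set.range v) = ⊤ := by
    rw [← hspan _ u v hsys]; exact hspan_u
  -- symmetric matrices from upper-triangular coefficient vectors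
  let T := {p : Fin C.rank × Fin C.rank // p.1 ≤ p.2}
  let symOf : (T → ℝ) → Matrix (Fin C.rank) (Fin C.rank) ℝ := fun a => Matrix.of fun p q =>
    if hpq : p ≤ q then a ⟨(p, q), hpq⟩ else a ⟨(q, p), le_of_lt (not_le.mp hpq)⟩
  have hsymOf_symm : ∀ a, (symOf a).IsSymm := fun a => by
    ext p q
    simp only [symOf, Matrix.transpose_apply, Matrix.of_apply]
    by_cases hpq : p ≤ q
    · by_cases hqp : q ≤ p
      · have : p = q := le_antisymm hpq hqp
        subst this; rfl
      · rw [dif_pos hpq, dif_neg hqp]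
    · have hqp : q ≤ p := le_of_lt (not_le.mp hpq)
      rw [dif_neg hpq, dif_pos hqp]
  let z : Fin n ⊕ Fin m → EuclideanSpace ℝ (Fin C.rank) := Sum.elim u v
  let Φ : (T → ℝ) →ₗ[ℝ] (Fin n ⊕ Fin m → ℝ) :=
    { toFun := fun a i => ∑ p, ∑ q, symOf a p q * (z i p * z i q)
      map_add' := fun a b => by
        funext i
        simp only [Pi.add_apply, ← Finset.sum_add_distrib]
        refine Finset.sum_congr rfl fun p _ => Finset.sum_congr rfl fun q _ => ?_
        simp only [symOf, Matrix.of_apply]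
        split_ifs <;> simp only [Pi.add_apply] <;> ring
      map_smul' := fun c a => by
        funext i
        simp only [Pi.smul_apply, smul_eq_mul, RingHom.id_apply, Finset.mul_sum]
        refine Finset.sum_congr rfl fun p _ => Finset.sum_congr rfl fun q _ => ?_
        simp only [symOf, Matrix.of_apply]
        split_ifs <;> simp only [Pi.smul_apply, smul_eq_mul] <;> ring }
  have hΦinj : Function.Injective Φ := by
    rw [← LinearMap.ker_eq_bot, LinearMap.ker_eq_bot']
    intro a ha
    have hA0 : symOf a = 0 := by
      refine litam_of_mem_extremePoints hC hsys hu1 hv1 hspan_u hspan_v (symOf a) (hsymOf_symm a)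
        (fun s => ?_) (fun t => ?_)
      · have h1 := congrFun ha (Sum.inl s)
        simpa [Φ, z] using h1
      · have h1 := congrFun ha (Sum.inr t)
        simpa [Φ, z] using h1
    funext ⟨⟨p, q⟩, hpq⟩
    have := congrFun (congrFun hA0 p) q
    simp only [symOf, Matrix.of_apply, Matrix.zero_apply, dif_pos hpq] at this
    exact this
  -- Tsirelson's identity (Theorem 3.9 (i)) for the system `(u, v)`: a nonzero relation among the dyads
  obtain ⟨lam, μ, -, -, hne, hid⟩ := GriblingDelaatLaurent2017_thm39i hn hm hC hsys
  let wv : Fin n ⊕ Fin m → ℝ := Sum.elim lam fun t => -μ t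
  have hwv : wv ≠ 0 := by
    intro h0
    apply hne
    constructor
    · funext s; have := congrFun h0 (Sum.inl s); simpa [wv] using this
    · funext t; have := congrFun h0 (Sum.inr t); simpa [wv] using this
  have hrel : ∀ p q, ∑ i, wv i * (z i p * z i q) = 0 := fun p q => by
    rw [Fintype.sum_sum_type]
    simp only [wv, z, Sum.elim_inl, Sum.elim_inr, neg_mul, Finset.sum_neg_distrib, hid p q,
      add_neg_cancel]
  have horth : ∀ a, ∑ i, wv i * Φ a i = 0 := fun a => by
    show ∑ i, wv i * ∑ p, ∑ q, symOf a p q * (z i p * z i q) = 0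
    calc ∑ i, wv i * ∑ p, ∑ q, symOf a p q * (z i p * z i q)
        = ∑ p, ∑ q, symOf a p q * ∑ i, wv i * (z i p * z i q) := by
          simp only [Finset.mul_sum]
          rw [Finset.sum_comm]
          refine Finset.sum_congr rfl fun p _ => ?_
          rw [Finset.sum_comm]
          exact Finset.sum_congr rfl fun q _ => Finset.sum_congr rfl fun i _ => by ring
      _ = 0 := Finset.sum_eq_zero fun p _ => Finset.sum_eq_zero fun q _ => by rw [hrel, mul_zero]
  -- the extended map `(A, c) ↦ Φ A + c • wv` is still injective
  let Ψ : ((T → ℝ) × ℝ) →ₗ[ℝ] (Fin n ⊕ Fin m → ℝ) :=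
    Φ.coprod (LinearMap.toSpanSingleton ℝ (Fin n ⊕ Fin m → ℝ) wv)
  have hΨinj : Function.Injective Ψ := by
    rw [← LinearMap.ker_eq_bot, LinearMap.ker_eq_bot']
    rintro ⟨a, c⟩ hac
    rw [LinearMap.coprod_apply, LinearMap.toSpanSingleton_apply] at hac
    have hc : c = 0 := by
      have h1 := congrArg (fun f : Fin n ⊕ Fin m → ℝ => ∑ i, wv i * f i) hac
      simp only [Pi.add_apply, Pi.smul_apply, smul_eq_mul, Pi.zero_apply, mul_zero,
        Finset.sum_const_zero, mul_add, Finset.sum_add_distrib, horth a, zero_add] at h1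
      have h2 : c * ∑ i, wv i * wv i = 0 := by
        rw [Finset.mul_sum, ← h1]
        exact Finset.sum_congr rfl fun i _ => by ring
      rcases mul_eq_zero.mp h2 with h3 | h3
      · exact h3
      · exfalso
        apply hwv
        funext i
        exact mul_self_eq_zero.mp ((Finset.sum_eq_zero_iff_of_nonneg fun j _ =>
          mul_self_nonneg (wv j)).mp h3 i (Finset.mem_univ i))
    rw [hc, zero_smul, add_zero] at hac
    have ha : a = 0 := hΦinj (by rw [hac, map_zero])
    rw [ha, hc]
    rfl
  have hle := LinearMap.finrank_le_finrank_of_injective hΨinj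
  rw [Module.finrank_prod, Module.finrank_self, Module.finrank_fintype_fun_eq_card,
    Module.finrank_fintype_fun_eq_card, Fintype.card_sum, Fintype.card_fin, Fintype.card_fin] at hle
  have hcard : Fintype.card T = (C.rank + 1).choose 2 := by
    rw [← Fintype.card_congr (Sym2.sortEquiv (α := Fin C.rank)), Sym2.card, Fintype.card_fin]
  rw [hcard] at hle
  omega

/-- **Tsirelson's bound is tight** (GdLL p10: "Our first construction in the next section provides
instances where the bound (eqrankC) is tight"; p11: the family `C_1` of extreme points of `Cor(m,n)`
with `rank(C_1) = r`, `m = r`, `n = binom(r,2)+1` "thus shows that inequality (eqrankC) is tight"): for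
the extreme correlation `gdllCorrelation r ∈ Cor(r, binom(r,2)+1)` of Theorem 3.11 (i),
`binom(rank C_1 + 1, 2) = m + n − 1`. [cite: GriblingDelaatLaurent2017, §3.2–3.3 (p10–p11)] -/
theorem GriblingDelaatLaurent2017_cor310_tight {r : ℕ} (hr : 1 ≤ r) :
    ((gdllCorrelation r).rank + 1).choose 2 = r + Fintype.card (GdllIdx r) - 1 := by
  rw [rank_gdllCorrelation hr, card_gdllIdx, Nat.choose_succ_succ', Nat.choose_one_right,
    Nat.choose_two_right]
  omega

end TsirelsonIdentity

/-! ### The elliptope and Li–Tam's characterization of its extreme points (Theorem 3.5) (appended) -/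

section LiTam

open Matrix Finset
open scoped RealInnerProductSpace MatrixOrder

/-- **The elliptope** `𝓔_n` (GdLL p08, verbatim: "The elliptope `𝓔_n` is defined as
`𝓔_n = {E ∈ 𝒮^n_+ : E_ii = 1 for i = 1,…,n}`, its elements are the correlation matrices, which
can alternatively be defined as all matrices of the form `(⟨z_i,z_j⟩)_{i,j=1}^n` for some real unit
vectors `z_1,…,z_n ∈ ℝ^d` (`d ≥ 1`)"): the real positive semidefinite `n × n` matrices with unit
diagonal. [cite: GriblingDelaatLaurent2017, §3.1 (p08)] -/
private def idxElliptope (ι : Type*) [Fintype ι] : Set (Matrix ι ι ℝ) :=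
  {E | E.PosSemidef ∧ ∀ i, E i i = 1}

/-- Unfolding of `idxElliptope`. [cite: GriblingDelaatLaurent2017, §3.1 (p08)] -/
private theorem mem_idxElliptope {ι : Type*} [Fintype ι] {E : Matrix ι ι ℝ} :
    E ∈ idxElliptope ι ↔ E.PosSemidef ∧ ∀ i, E i i = 1 := Iff.rfl

/-- The elliptope is convex (GdLL p08: "`Cor(m,n)` is a projection of the elliptope `𝓔_{m+n}` and
therefore a convex set"). [cite: GriblingDelaatLaurent2017, §3.1 (p08)] -/
private theorem convex_idxElliptope (ι : Type*) [Fintype ι] : Convex ℝ (idxElliptope ι) := by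
  intro E₁ h₁ E₂ h₂ a b ha hb hab
  refine ⟨(h₁.1.smul ha).add (h₂.1.smul hb), fun i => ?_⟩
  simp only [Matrix.add_apply, Matrix.smul_apply, smul_eq_mul, h₁.2 i, h₂.2 i, mul_one, hab]

/-- The Gram matrix of unit vectors is a correlation matrix (GdLL p08: the elements of `𝓔_n` are
"all matrices of the form `(⟨z_i,z_j⟩)_{i,j=1}^n` for some real unit vectors").
[cite: GriblingDelaatLaurent2017, §3.1 (p08)] -/
private theorem gram_mem_idxElliptope {ι : Type*} [Fintype ι] {F : Type*} [NormedAddCommGroup F]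
    [InnerProductSpace ℝ F] (z : ι → F) (hz1 : ∀ i, ‖z i‖ = 1) :
    Matrix.gram ℝ z ∈ idxElliptope ι :=
  ⟨Matrix.posSemidef_gram ℝ z, fun i => by
    rw [Matrix.gram_apply, real_inner_self_eq_norm_sq, hz1, one_pow]⟩

variable {ι : Type*} [Fintype ι] [DecidableEq ι] {r : ℕ}

omit [Fintype ι] [DecidableEq ι] in
/-- `(ZᵀAZ)_{ij} = z_iᵀAz_j` for the matrix `Z` with columns `z_i`. [folklore] -/
private theorem transpose_mul_mul_apply (z : ι → EuclideanSpace ℝ (Fin r))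
    (A : Matrix (Fin r) (Fin r) ℝ) (i j : ι) :
    ((Matrix.of fun p k => z k p)ᵀ * A * Matrix.of fun p k => z k p) i j =
      ∑ p, ∑ q, A p q * (z i p * z j q) := by
  simp only [Matrix.mul_apply, Matrix.transpose_apply, Matrix.of_apply, Finset.sum_mul]
  rw [Finset.sum_comm]
  exact Finset.sum_congr rfl fun p _ => Finset.sum_congr rfl fun q _ => by ring

omit [Fintype ι] [DecidableEq ι] in
/-- A real matrix `A` with `z_iᵀAz_j = 0` for all `i, j`, the `z_i` spanning, is zero. [folklore] -/
private theorem eq_zero_of_forall_quad_eq_zero (z : ι → EuclideanSpace ℝ (Fin r))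
    (hz : Submodule.span ℝ (Set.range z) = ⊤) (A : Matrix (Fin r) (Fin r) ℝ)
    (hA0 : ∀ i j, ∑ p, ∑ q, A p q * (z i p * z j q) = 0) : A = 0 := by
  have hAz : ∀ j p, ∑ q, A p q * z j q = 0 := by
    intro j
    let a : EuclideanSpace ℝ (Fin r) := WithLp.toLp 2 fun p => ∑ q, A p q * z j q
    have ha : a = 0 := eq_zero_of_inner_spanning z hz a fun i => by
      rw [← hA0 i j]
      simp only [a, EuclideanSpace.inner_eq_star_dotProduct, star_trivial, dotProduct, Finset.mul_sum]
      exact Finset.sum_congr rfl fun p _ => Finset.sum_congr rfl fun q _ => by ring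
    intro p
    have := congrArg (fun w : EuclideanSpace ℝ (Fin r) => w p) ha
    simpa [a] using this
  ext p q
  rw [Matrix.zero_apply]
  let row : EuclideanSpace ℝ (Fin r) := WithLp.toLp 2 fun q => A p q
  have hr : row = 0 := eq_zero_of_inner_spanning z hz row fun j => by
    rw [← hAz j p]
    simp only [row, EuclideanSpace.inner_eq_star_dotProduct, star_trivial, dotProduct]
    exact Finset.sum_congr rfl fun q _ => mul_comm _ _
  have := congrArg (fun w : EuclideanSpace ℝ (Fin r) => w q) hr
  simpa [row] using this

/-- **GdLL Theorem 3.5 — Li–Tam's characterization of the extreme points of the elliptope** (p09,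
after [LiTam] = C.-K. Li, B.-S. Tam, *A note on extreme correlation matrices*, SIAM J. Matrix Anal.
Appl. 15 (1994) 903–908, verbatim: "Consider a matrix `E ∈ 𝓔_n` with rank `r` and unit vectors
`z_1,…,z_n ∈ ℝ^r` such that `E = Gram(z_1,…,z_n)`. Then `E` is an extreme point of `𝓔_n` if and only
if `binom(r+1,2) = dim(span{z_1z_1ᵀ,…,z_nz_nᵀ})`."). Typed for a finite index type `ι` in place of
`[n]`, unit vectors `z_i ∈ ℝ^r` spanning `ℝ^r` (equivalently `rank E = r`), and the dimension
condition in its dual form: the dyads `z_iz_iᵀ`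
span the `binom(r+1,2)`-dimensional space `𝒮^r` iff the only symmetric `A` with `z_iᵀAz_i = 0` for
all `i` is `A = 0`. Proof (standard): "only if" — for such an `A ≠ 0` and small `ε`,
`E ± εZᵀAZ = Zᵀ(I ± εA)Z ∈ 𝓔_n` has midpoint `E`; "if" — for `E = aE₁ + bE₂` in `𝓔_n` the
perturbation `D = E₁ − E` is psd-dominated (`E + D ⪰ 0`, `bE − aD ⪰ 0`), hence kills `ker Z` and is
of the form `ZᵀAZ` (`A = RᵀDR` for a right inverse `R` of `Z`) with `z_iᵀAz_i = D_ii = 0`, so `A = 0`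
and `D = 0`. [cite: GriblingDelaatLaurent2017, Thm. 3.5 (p09)] -/
private theorem litam_gram_iff (z : ι → EuclideanSpace ℝ (Fin r)) (hz1 : ∀ i, ‖z i‖ = 1)
    (hz : Submodule.span ℝ (Set.range z) = ⊤) :
    Matrix.gram ℝ z ∈ Set.extremePoints ℝ (idxElliptope ι) ↔
      ∀ A : Matrix (Fin r) (Fin r) ℝ, A.IsSymm →
        (∀ i, ∑ p, ∑ q, A p q * (z i p * z i q) = 0) → A = 0 := by
  classical
  -- the matrix `Z` with columns `z_i`, `Gram(z) = ZᵀZ`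
  let Zm : Matrix (Fin r) ι ℝ := Matrix.of fun p k => z k p
  have hinner : ∀ i j, ⟪z i, z j⟫ = ∑ p, z i p * z j p := fun i j => by
    rw [EuclideanSpace.inner_eq_star_dotProduct, star_trivial, dotProduct]
    exact Finset.sum_congr rfl fun p _ => mul_comm _ _
  have hG : ∀ i j, Matrix.gram ℝ z i j = ⟪z i, z j⟫ := fun i j => Matrix.gram_apply z i j
  have hzz : ∀ i, ⟪z i, z i⟫ = 1 := fun i => by rw [real_inner_self_eq_norm_sq, hz1, one_pow]
  have hGZ : Matrix.gram ℝ z = Zmᵀ * Zm := by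
    ext i j
    rw [hG, hinner, Matrix.mul_apply]
    rfl
  constructor
  · -- "only if": perturb along `ZᵀAZ`
    intro hext A hA hAd
    let qA : ι → ι → ℝ := fun i j => ∑ p, ∑ q, A p q * (z i p * z j q)
    let E : ℝ → Matrix ι ι ℝ := fun ε => Zmᵀ * (1 + ε • A) * Zm
    have hE : ∀ ε i j, E ε i j = ⟪z i, z j⟫ + ε * qA i j := by
      intro ε i j
      have h1 : E ε i j = ∑ p, ∑ q, z i p * (1 + ε • A) p q * z j q := by
        simp only [E, Zm, Matrix.mul_apply, Matrix.transpose_apply, Matrix.of_apply, Finset.sum_mul]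
        rw [Finset.sum_comm]
      rw [h1]
      simp only [Matrix.add_apply, Matrix.one_apply, Matrix.smul_apply, smul_eq_mul, mul_add, add_mul,
        Finset.sum_add_distrib]
      congr 1
      · simp only [mul_ite, mul_one, mul_zero, ite_mul, zero_mul, Finset.sum_ite_eq, Finset.mem_univ,
          if_true]
        rw [hinner]
      · simp only [qA, Finset.mul_sum]
        exact Finset.sum_congr rfl fun p _ => Finset.sum_congr rfl fun q _ => by ring
    set S : ℝ := ∑ p, ∑ q, |A p q| with hSdef
    have hS0 : 0 ≤ S := Finset.sum_nonneg fun p _ => Finset.sum_nonneg fun q _ => abs_nonneg _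
    set ε : ℝ := 1 / (1 + S) with hεdef
    have hεpos : 0 < ε := by rw [hεdef]; positivity
    have hεS : ∀ δ : ℝ, |δ| = ε → |δ| * S ≤ 1 := fun δ hδ => by
      rw [hδ, hεdef, div_mul_eq_mul_div, one_mul, div_le_one (by positivity)]
      linarith
    have hpsd : ∀ δ : ℝ, |δ| = ε → (E δ).PosSemidef := fun δ hδ => by
      have h1 := (posSemidef_one_add_smul A hA δ (hεS δ hδ)).conjTranspose_mul_mul_same Zm
      rwa [conjTranspose_eq_transpose_of_trivial] at h1
    have hdiagE : ∀ δ i, E δ i i = 1 := fun δ i => by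
      rw [hE, hzz, show qA i i = 0 from hAd i, mul_zero, add_zero]
    have hmem : ∀ δ : ℝ, |δ| = ε → E δ ∈ idxElliptope ι := fun δ hδ => ⟨hpsd δ hδ, hdiagE δ⟩
    have hseg : Matrix.gram ℝ z ∈ openSegment ℝ (E ε) (E (-ε)) := by
      refine ⟨1 / 2, 1 / 2, by norm_num, by norm_num, by norm_num, ?_⟩
      ext i j
      simp only [Matrix.add_apply, Matrix.smul_apply, smul_eq_mul, hE, hG]
      ring
    have hext' := hext.2 (hmem ε (abs_of_pos hεpos)) (hmem (-ε) (by rw [abs_neg, abs_of_pos hεpos]))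
      hseg
    refine eq_zero_of_forall_quad_eq_zero z hz A fun i j => ?_
    have h1 := congrFun (congrFun hext' i) j
    rw [hE, hG] at h1
    have h2 : ε * qA i j = 0 := by linarith
    exact (mul_eq_zero.mp h2).resolve_left hεpos.ne'
  · -- "if": a perturbation inside the elliptope is `ZᵀAZ` with zero diagonal
    intro hLT
    refine ⟨gram_mem_idxElliptope z hz1, ?_⟩
    intro E₁ hE₁ E₂ hE₂ hsegm
    obtain ⟨a, b, ha, hb, hab, hEq⟩ := hsegm
    set G := Matrix.gram ℝ z with hGdef
    -- the perturbation `D`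
    set D : Matrix ι ι ℝ := E₁ - G with hDdef
    have hE₁D : E₁ = G + D := by rw [hDdef]; abel
    have hbE₂ : ∀ i j, b * E₂ i j = b * G i j - a * D i j := fun i j => by
      have h := congrFun (congrFun hEq i) j
      simp only [Matrix.add_apply, Matrix.smul_apply, smul_eq_mul] at h
      rw [hDdef, Matrix.sub_apply]
      linear_combination h - G i j * hab
    have hDsymm : ∀ i j, D j i = D i j := fun i j => by
      rw [hDdef, Matrix.sub_apply, Matrix.sub_apply]
      have h1 : E₁ j i = E₁ i j := by simpa using hE₁.1.1.apply i j
      have h2 : G j i = G i j := by rw [hG, hG, real_inner_comm]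
      rw [h1, h2]
    have hDT : Dᵀ = D := by
      ext i j
      rw [Matrix.transpose_apply]
      exact hDsymm i j
    have hDdiag : ∀ i, D i i = 0 := fun i => by
      have hGii : G i i = 1 := by rw [hG, hzz]
      rw [hDdef, Matrix.sub_apply, hE₁.2 i, hGii, sub_self]
    -- Step 1: `D` kills `ker Z`
    have hDker : ∀ v : ι → ℝ, Zm *ᵥ v = 0 → D *ᵥ v = 0 := by
      intro v hv
      have hGv : G *ᵥ v = 0 := by rw [hGZ, ← Matrix.mulVec_mulVec, hv, Matrix.mulVec_zero]
      have q1 : 0 ≤ v ⬝ᵥ (E₁ *ᵥ v) := by simpa using hE₁.1.dotProduct_mulVec_nonneg v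
      have q2 : 0 ≤ v ⬝ᵥ (E₂ *ᵥ v) := by simpa using hE₂.1.dotProduct_mulVec_nonneg v
      have hE₁v : E₁ *ᵥ v = D *ᵥ v := by rw [hE₁D, Matrix.add_mulVec, hGv, zero_add]
      have hbE₂v : b * (v ⬝ᵥ (E₂ *ᵥ v)) = -a * (v ⬝ᵥ (D *ᵥ v)) := by
        have h1 : b • E₂ = b • G - a • D := by
          ext i j
          simp only [Matrix.smul_apply, Matrix.sub_apply, smul_eq_mul]
          exact hbE₂ i j
        calc b * (v ⬝ᵥ (E₂ *ᵥ v)) = v ⬝ᵥ ((b • E₂) *ᵥ v) := by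
              rw [Matrix.smul_mulVec, dotProduct_smul, smul_eq_mul]
          _ = -a * (v ⬝ᵥ (D *ᵥ v)) := by
              rw [h1, Matrix.sub_mulVec, Matrix.smul_mulVec, Matrix.smul_mulVec, hGv,
                smul_zero, zero_sub, dotProduct_neg, dotProduct_smul, smul_eq_mul]
              ring
      have hq0 : v ⬝ᵥ (D *ᵥ v) = 0 := by
        have h3 : 0 ≤ v ⬝ᵥ (D *ᵥ v) := by rw [← hE₁v]; exact q1
        nlinarith
      have hE₁v0 : E₁ *ᵥ v = 0 := by
        have h4 : star v ⬝ᵥ (E₁ *ᵥ v) = 0 := by rw [star_trivial, hE₁v, hq0]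
        exact (hE₁.1.dotProduct_mulVec_zero_iff v).mp h4
      rw [← hE₁v, hE₁v0]
    -- Step 2: a right inverse `R` of `Z` (the `z_i` span `ℝ^r`)
    have hsurj : Function.Surjective (Matrix.toLin' Zm) := fun w => by
      have hw : (WithLp.toLp 2 w : EuclideanSpace ℝ (Fin r)) ∈ Submodule.span ℝ (Set.range z) := by
        rw [hz]; exact Submodule.mem_top
      obtain ⟨c, hc⟩ := (Submodule.mem_span_range_iff_exists_fun ℝ).mp hw
      refine ⟨c, funext fun p => ?_⟩
      have h1 := congrArg (fun v : EuclideanSpace ℝ (Fin r) => ⟪EuclideanSpace.single p (1 : ℝ), v⟫) hc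
      simp only [inner_sum, real_inner_smul_right, inner_single_one_left] at h1
      rw [Matrix.toLin'_apply, Matrix.mulVec, dotProduct]
      simp only [Zm, Matrix.of_apply]
      rw [← h1]
      exact Finset.sum_congr rfl fun k _ => mul_comm _ _
    obtain ⟨g, hg⟩ := LinearMap.exists_rightInverse_of_surjective (Matrix.toLin' Zm)
      (LinearMap.range_eq_top.mpr hsurj)
    let R : Matrix ι (Fin r) ℝ := LinearMap.toMatrix' g
    have hZR : Zm * R = 1 := by
      have h1 := congrArg LinearMap.toMatrix' hg
      rwa [LinearMap.toMatrix'_comp, LinearMap.toMatrix'_toLin', LinearMap.toMatrix'_id] at h1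
    -- Step 3: `D (RZ) = D`, so `ZᵀAZ = D` for `A = RᵀDR`
    have hDP : D * (R * Zm) = D := by
      apply Matrix.toLin'.injective
      apply LinearMap.ext
      intro v
      rw [Matrix.toLin'_apply, Matrix.toLin'_apply, ← Matrix.mulVec_mulVec]
      have hker : Zm *ᵥ ((R * Zm) *ᵥ v - v) = 0 := by
        rw [Matrix.mulVec_sub, Matrix.mulVec_mulVec, ← Matrix.mul_assoc, hZR, Matrix.one_mul, sub_self]
      have h1 := hDker _ hker
      rw [Matrix.mulVec_sub, sub_eq_zero] at h1
      exact h1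
    let A : Matrix (Fin r) (Fin r) ℝ := Rᵀ * D * R
    have hAsymm : A.IsSymm := by
      show (Rᵀ * D * R)ᵀ = Rᵀ * D * R
      rw [Matrix.transpose_mul, Matrix.transpose_mul, Matrix.transpose_transpose, hDT, Matrix.mul_assoc]
    have hZAZ : Zmᵀ * A * Zm = D := by
      show Zmᵀ * (Rᵀ * D * R) * Zm = D
      have h1 : Zmᵀ * (Rᵀ * D * R) * Zm = (R * Zm)ᵀ * (D * (R * Zm)) := by
        rw [Matrix.transpose_mul]
        simp only [Matrix.mul_assoc]
      rw [h1, hDP]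
      have h2 : (R * Zm)ᵀ * D = (D * (R * Zm))ᵀ := by rw [Matrix.transpose_mul D (R * Zm), hDT]
      rw [h2, hDP, hDT]
    -- Step 4: the Li–Tam condition forces `A = 0`, hence `D = 0`
    have hA0 : A = 0 := hLT A hAsymm fun i => by
      rw [← transpose_mul_mul_apply z A i i, hZAZ, hDdiag]
    have hD0 : D = 0 := by rw [← hZAZ, hA0, Matrix.mul_zero, Matrix.zero_mul]
    rw [hE₁D, hD0, add_zero]

end LiTam

/-! ### Extreme bipartite correlations and the elliptope (Theorem 3.3) (appended) -/

section ExtremeViaElliptope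

open Matrix Finset
open scoped RealInnerProductSpace MatrixOrder

variable {n m : ℕ}

/-- A real psd matrix indexed by `[n] ⊔ [m]` is a Gram matrix of vectors of `ℝ^{n+m}` (`E = BᵀB`).
[folklore] -/
private theorem exists_inner_eq_of_posSemidef {E : Matrix (Fin n ⊕ Fin m) (Fin n ⊕ Fin m) ℝ}
    (hE : E.PosSemidef) :
    ∃ w : Fin n ⊕ Fin m → EuclideanSpace ℝ (Fin (n + m)), ∀ i j, ⟪w i, w j⟫ = E i j := by
  classical
  obtain ⟨B, hB⟩ := CStarAlgebra.nonneg_iff_eq_star_mul_self.mp hE.nonneg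
  have hBT : star B = Bᵀ := by
    rw [star_eq_conjTranspose, conjTranspose_eq_transpose_of_trivial]
  let e : Fin n ⊕ Fin m ≃ Fin (n + m) := finSumFinEquiv
  refine ⟨fun i => WithLp.toLp 2 fun k => B (e.symm k) i, fun i j => ?_⟩
  rw [EuclideanSpace.inner_toLp_toLp, star_trivial, dotProduct, hB, hBT, Matrix.mul_apply]
  simp only [Matrix.transpose_apply]
  rw [show ∑ x, B x i * B x j = ∑ k, B (e.symm k) i * B (e.symm k) j from
    (e.symm.sum_comp (fun x => B x i * B x j)).symm]
  exact Finset.sum_congr rfl fun k _ => mul_comm _ _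

/-- **GdLL Theorem 3.3 — extreme bipartite correlations via the elliptope** (p09, verbatim: "A matrix
`C` is an extreme point of `Cor(m,n)` if and only if `C` has a unique extension to a matrix
`E ∈ 𝓔_{m+n}` and `E` is an extreme point of `𝓔_{m+n}`"; GdLL: "Direct application of Lemma 3.1
[ELV14] and Lemma 3.2 (ii)"), for `n, m ≥ 1` (the standing Bell-scenario assumption), with the
elliptope indexed by `[n] ⊔ [m]` and "extension" = an `E ∈ 𝓔` whose off-diagonal block is `C`
(the projection `π`, p08). Own assembly (not through the face lemma [ELV14]): "only if" — every
extension is the Gram matrix of a `C`-system, hence equals `Gram(u ⊔ v)` for the unit `C`-system in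
`ℝ^{rank C}` (`gram_sumElim_eq_of_mem_extremePoints`), which is an extreme point of `𝓔` by Li–Tam
(`GriblingDelaatLaurent2017_thm35`) and the necessity of the Li–Tam condition
(`litam_of_mem_extremePoints`); "if" — extensions of `C₁, C₂` with `C = aC₁ + bC₂` combine to an
extension of `C`, which is the extreme `E`. [cite: GriblingDelaatLaurent2017, Thm. 3.3 (p09)] -/
private theorem thm33_sum {C : Matrix (Fin n) (Fin m) ℝ} (hn : 0 < n) (hm : 0 < m) :
    C ∈ Set.extremePoints ℝ (quantumCorrelations n m) ↔
      ∃ E ∈ Set.extremePoints ℝ (idxElliptope (Fin n ⊕ Fin m)),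
        ∀ E' ∈ idxElliptope (Fin n ⊕ Fin m), (∀ s t, E' (Sum.inl s) (Sum.inr t) = C s t) ↔ E' = E := by
  classical
  constructor
  · intro hC
    -- a unit `C`-system in `ℝ^{rank C}` spanning on both sides
    obtain ⟨hspan, -⟩ := Tsirelson1987_lemma12_holds n m C hn hm hC
    obtain ⟨u0, v0, hu0, hv0, hCuv⟩ := hC.1
    have hsys0 : IsCSystem C u0 v0 := ⟨fun s => (hu0 s).le, fun t => (hv0 t).le, hCuv⟩
    let W : Submodule ℝ (EuclideanSpace ℝ (Fin (n + m))) := Submodule.span ℝ (Set.range u0)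
    have hW : Module.finrank ℝ W = C.rank := finrank_span_eq_rank_of_mem_extremePoints hn hm hC hsys0
    let φ : W ≃ₗᵢ[ℝ] EuclideanSpace ℝ (Fin C.rank) :=
      ((stdOrthonormalBasis ℝ W).reindex (finCongr hW)).repr
    have huW : ∀ s, u0 s ∈ W := fun s => Submodule.subset_span ⟨s, rfl⟩
    have hvW : ∀ t, v0 t ∈ W := fun t => by
      show v0 t ∈ Submodule.span ℝ (Set.range u0)
      rw [hspan _ u0 v0 hsys0]
      exact Submodule.subset_span ⟨t, rfl⟩
    let u : Fin n → EuclideanSpace ℝ (Fin C.rank) := fun s => φ ⟨u0 s, huW s⟩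
    let v : Fin m → EuclideanSpace ℝ (Fin C.rank) := fun t => φ ⟨v0 t, hvW t⟩
    have hu1 : ∀ s, ‖u s‖ = 1 := fun s => by simp only [u, LinearIsometryEquiv.norm_map]; exact hu0 s
    have hv1 : ∀ t, ‖v t‖ = 1 := fun t => by simp only [v, LinearIsometryEquiv.norm_map]; exact hv0 t
    have hsys : IsCSystem C u v := by
      refine ⟨fun s => (hu1 s).le, fun t => (hv1 t).le, fun s t => ?_⟩
      simp only [u, v, LinearIsometryEquiv.inner_map_map, Submodule.coe_inner]
      exact hCuv s t
    have hspan_u : Submodule.span ℝ (Set.range u) = ⊤ := by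
      apply Submodule.eq_top_of_finrank_eq
      rw [finrank_euclideanSpace_fin]
      exact finrank_span_eq_rank_of_mem_extremePoints hn hm hC hsys
    have hspan_v : Submodule.span ℝ (Set.range v) = ⊤ := by
      rw [← hspan _ u v hsys]; exact hspan_u
    -- its Gram matrix `E` is an extreme point of the elliptope (Li–Tam)
    let z : Fin n ⊕ Fin m → EuclideanSpace ℝ (Fin C.rank) := Sum.elim u v
    have hz1 : ∀ i, ‖z i‖ = 1 := fun i => by
      cases i with
      | inl s => exact hu1 s
      | inr t => exact hv1 t
    have hz : Submodule.span ℝ (Set.range z) = ⊤ := by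
      apply eq_top_iff.mpr
      rw [← hspan_u]
      exact Submodule.span_mono (by rintro _ ⟨s, rfl⟩; exact ⟨Sum.inl s, rfl⟩)
    have hEext : Matrix.gram ℝ z ∈ Set.extremePoints ℝ (idxElliptope (Fin n ⊕ Fin m)) :=
      (litam_gram_iff z hz1 hz).mpr fun A hA hAz =>
        litam_of_mem_extremePoints hC hsys hu1 hv1 hspan_u hspan_v A hA
          (fun s => hAz (Sum.inl s)) (fun t => hAz (Sum.inr t))
    refine ⟨Matrix.gram ℝ z, hEext, fun E' hE' => ⟨fun hblock => ?_, fun h => ?_⟩⟩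
    · -- uniqueness of the extension: `E'` is the Gram matrix of a `C`-system
      obtain ⟨w, hw⟩ := exists_inner_eq_of_posSemidef hE'.1
      have hwn : ∀ i, ‖w i‖ ≤ 1 := fun i => by
        have h1 : ‖w i‖ ^ 2 = 1 := by rw [← real_inner_self_eq_norm_sq, hw, hE'.2 i]
        nlinarith [norm_nonneg (w i)]
      have hsys' : IsCSystem C (fun s => w (Sum.inl s)) (fun t => w (Sum.inr t)) :=
        ⟨fun s => hwn _, fun t => hwn _, fun s t => by rw [hw, hblock]⟩
      have hg := gram_sumElim_eq_of_mem_extremePoints hn hm hC hsys' hsys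
      ext i j
      have h1 := congrFun (congrFun hg i) j
      rw [Matrix.gram_apply] at h1
      have h2 : ∀ k, Sum.elim (fun s => w (Sum.inl s)) (fun t => w (Sum.inr t)) k = w k := fun k => by
        cases k <;> rfl
      rw [h2, h2, hw] at h1
      exact h1
    · subst h
      intro s t
      rw [Matrix.gram_apply]
      show ⟪u s, v t⟫ = C s t
      exact (hsys.2.2 s t).symm
  · rintro ⟨E, hEext, huniq⟩
    have hEC : ∀ s t, E (Sum.inl s) (Sum.inr t) = C s t := (huniq E hEext.1).mpr rfl
    -- extensions of the points of `Cor(n,m)`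
    have hext_of : ∀ C₁ ∈ quantumCorrelations n m, ∃ E₁ ∈ idxElliptope (Fin n ⊕ Fin m),
        ∀ s t, E₁ (Sum.inl s) (Sum.inr t) = C₁ s t := by
      rintro C₁ ⟨u₁, v₁, hu₁, hv₁, hC₁⟩
      refine ⟨Matrix.gram ℝ (Sum.elim u₁ v₁), gram_mem_idxElliptope _ fun i => ?_, fun s t => ?_⟩
      · cases i with
        | inl s => exact hu₁ s
        | inr t => exact hv₁ t
      · rw [Matrix.gram_apply, Sum.elim_inl, Sum.elim_inr, hC₁]
    refine ⟨?_, ?_⟩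
    · -- `C = π(E) ∈ Cor(n,m)`
      have hCE : C = Matrix.of fun s t => E (Sum.inl s) (Sum.inr t) := by
        ext s t; rw [Matrix.of_apply, hEC]
      rw [hCE]
      exact offDiag_mem_quantumCorrelations_of_posSemidef hEext.1.1 hEext.1.2
    · intro C₁ hC₁ C₂ hC₂ hsegm
      obtain ⟨a, b, ha, hb, hab, hCeq⟩ := hsegm
      obtain ⟨E₁, hE₁, hE₁C⟩ := hext_of C₁ hC₁
      obtain ⟨E₂, hE₂, hE₂C⟩ := hext_of C₂ hC₂
      have hE₀ : a • E₁ + b • E₂ ∈ idxElliptope (Fin n ⊕ Fin m) :=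
        convex_idxElliptope _ hE₁ hE₂ ha.le hb.le hab
      have hE₀C : ∀ s t, (a • E₁ + b • E₂) (Sum.inl s) (Sum.inr t) = C s t := fun s t => by
        rw [Matrix.add_apply, Matrix.smul_apply, Matrix.smul_apply, hE₁C, hE₂C, ← hCeq]
        rfl
      have hE₀E : a • E₁ + b • E₂ = E := (huniq _ hE₀).mp hE₀C
      have hE₁E : E₁ = E := hEext.2 hE₁ hE₂ ⟨a, b, ha, hb, hab, hE₀E⟩
      ext s t
      rw [← hE₁C, hE₁E, hEC]

end ExtremeViaElliptope

/-! ### Theorem 3.3 on the tree's `elliptope (n + m)` -/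

section ReindexElliptope

open Matrix

variable {n m : ℕ}

/-- Reindexing along `finSumFinEquiv` identifies the internal `[n] ⊔ [m]`-indexed elliptope with the
tree's `elliptope (n + m)`. [cite: GriblingDelaatLaurent2017, §3.1 (p08)] -/
private theorem reindex_mem_elliptope_iff (E : Matrix (Fin n ⊕ Fin m) (Fin n ⊕ Fin m) ℝ) :
    Matrix.reindex finSumFinEquiv finSumFinEquiv E ∈ elliptope (n + m) ↔
      E ∈ idxElliptope (Fin n ⊕ Fin m) := by
  rw [mem_idxElliptope]
  change (E.submatrix finSumFinEquiv.symm finSumFinEquiv.symm).PosSemidef ∧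
      (∀ i, E (finSumFinEquiv.symm i) (finSumFinEquiv.symm i) = 1) ↔ _
  rw [Matrix.posSemidef_submatrix_equiv]
  refine and_congr Iff.rfl ⟨fun h i => ?_, fun h i => h _⟩
  have := h (finSumFinEquiv i)
  rwa [Equiv.symm_apply_apply] at this

/-- The image of the internal elliptope under the reindexing is `elliptope (n + m)`.
[cite: GriblingDelaatLaurent2017, §3.1 (p08)] -/
private theorem image_reindex_idxElliptope :
    (Matrix.reindexLinearEquiv ℝ ℝ (finSumFinEquiv : Fin n ⊕ Fin m ≃ Fin (n + m))
      (finSumFinEquiv : Fin n ⊕ Fin m ≃ Fin (n + m))) ''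
        idxElliptope (Fin n ⊕ Fin m) = elliptope (n + m) := by
  ext F
  constructor
  · rintro ⟨E, hE, rfl⟩
    exact (reindex_mem_elliptope_iff E).2 hE
  · intro hF
    refine ⟨Matrix.reindex finSumFinEquiv.symm finSumFinEquiv.symm F, ?_, ?_⟩
    · rw [← reindex_mem_elliptope_iff]
      convert hF using 1
      ext i j; simp
    · change Matrix.reindex _ _ (Matrix.reindex _ _ F) = F
      ext i j; simp

/-- Extreme points correspond under the reindexing. [cite: GriblingDelaatLaurent2017, §3.1 (p08)] -/
private theorem reindex_mem_extremePoints_iff (E : Matrix (Fin n ⊕ Fin m) (Fin n ⊕ Fin m) ℝ) :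
    Matrix.reindex finSumFinEquiv finSumFinEquiv E ∈ Set.extremePoints ℝ (elliptope (n + m)) ↔
      E ∈ Set.extremePoints ℝ (idxElliptope (Fin n ⊕ Fin m)) := by
  let f := Matrix.reindexLinearEquiv ℝ ℝ (finSumFinEquiv : Fin n ⊕ Fin m ≃ Fin (n + m))
      (finSumFinEquiv : Fin n ⊕ Fin m ≃ Fin (n + m))
  rw [← image_reindex_idxElliptope, ← image_extremePoints f]
  change f E ∈ f '' _ ↔ _
  exact f.injective.mem_set_image

/-- **GdLL Theorem 3.3 — extreme bipartite correlations via the elliptope** (p09, verbatim: "A matrix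
`C` is an extreme point of `Cor(m,n)` if and only if `C` has a unique extension to a matrix
`E ∈ 𝓔_{m+n}` and `E` is an extreme point of `𝓔_{m+n}`"; "Direct application of Lemma 3.1 [ELV14] and
Lemma 3.2 (ii)"), for `n, m ≥ 1`, on the tree's `elliptope (n + m)`: an "extension" of `C` is an
`E ∈ 𝓔_{n+m}` whose off-diagonal block (rows `Fin.castAdd m s`, columns `Fin.natAdd n t`) is `C` (the
projection `π` of p08). Own assembly (over `[n] ⊔ [m]`, transported along `finSumFinEquiv`): "only if"
via the uniqueness of the Gram extension of an extreme `C` (`gram_sumElim_eq_of_mem_extremePoints`), the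
necessity of the Li–Tam condition (`litam_of_mem_extremePoints`) and Li–Tam; "if" by combining
extensions of `C₁, C₂`. [cite: GriblingDelaatLaurent2017, Thm. 3.3 (p09)] -/
theorem GriblingDelaatLaurent2017_thm33 {C : Matrix (Fin n) (Fin m) ℝ} (hn : 0 < n) (hm : 0 < m) :
    C ∈ Set.extremePoints ℝ (quantumCorrelations n m) ↔
      ∃ E ∈ Set.extremePoints ℝ (elliptope (n + m)),
        ∀ E' ∈ elliptope (n + m),
          (∀ s t, E' (Fin.castAdd m s) (Fin.natAdd n t) = C s t) ↔ E' = E := by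
  rw [thm33_sum hn hm]
  constructor
  · rintro ⟨E, hE, huniq⟩
    refine ⟨Matrix.reindex finSumFinEquiv finSumFinEquiv E, (reindex_mem_extremePoints_iff E).2 hE,
      fun F hF => ?_⟩
    have hF' : Matrix.reindex finSumFinEquiv.symm finSumFinEquiv.symm F ∈ idxElliptope (Fin n ⊕ Fin m) := by
      rw [← reindex_mem_elliptope_iff]
      convert hF using 1
      ext i j; simp
    have h := huniq _ hF'
    simp only [Matrix.reindex_apply, Matrix.submatrix_apply, Equiv.symm_symm,
      finSumFinEquiv_apply_left, finSumFinEquiv_apply_right] at h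
    rw [h]
    constructor
    · intro hEq
      rw [← hEq]
      ext i j; simp
    · intro hEq
      rw [hEq]
      ext i j; simp
  · rintro ⟨F, hF, huniq⟩
    refine ⟨Matrix.reindex finSumFinEquiv.symm finSumFinEquiv.symm F, ?_, fun E' hE' => ?_⟩
    · rw [← reindex_mem_extremePoints_iff]
      convert hF using 1
      ext i j; simp
    · have h := huniq _ ((reindex_mem_elliptope_iff E').2 hE')
      simp only [Matrix.reindex_apply, Matrix.submatrix_apply, finSumFinEquiv_symm_apply_castAdd,
        finSumFinEquiv_symm_apply_natAdd] at h
      rw [h]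
      constructor
      · intro hEq
        rw [← hEq]
        ext i j; simp
      · intro hEq
        rw [hEq]
        ext i j; simp

end ReindexElliptope

end Literature.Combinatorics.Optimization
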